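import Summits.CriticalPhenomena.SAWScalingLimit.Theses.SAWQuadrupoleWard
import Literature.Probability.RandomPlanarGeometry.SAWRestrictionCovariance
import Literature.Probability.RandomPlanarGeometry.DiagonalDressedSAW
import Literature.Probability.RandomPlanarGeometry.SAWScalingLimitFamily
import Summits.CriticalPhenomena.SAWScalingLimit.Theorems.SAWCircleScreeningScreeningRecursionLawReal

/-!
# Line `collar-step-telescoping` for the crux `BoundaryWard` (stmt-CriticalPhenomena-6556) of route `SAWQuadrupoleWard`

Crux (by name): `Summit.CriticalPhenomena.SAWScalingLimit.Theses.SAWQuadrupoleWard.BoundaryWard` — for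
every mesh normalisation `κ₁, κ₂` satisfying the interior Ward identity, along the flow `g` of a vector
field `u` holomorphic near `D̄` with `u(a) = u(b) = 0` mapping `D` into itself, the lattice restriction
of the critical SAW law to `D_t = g_t(D)` is generated by the collar covariance:
`E_{(D_t)_δ}[f] − E_{D_δ}[f] − ∫₀ᵗ C(s, δ) ds → 0` (`δ → 0⁺`), `C(s, δ) = Cov_{(D_s)_δ}(f, Q^κ_δ(2∂̄(χu)))`.

THE LINE = the crux-strategist's TYPED SPLIT (route re-audit 2026-08-17, bin RESTATED, BC2 redirect):
four pieces, one per mechanism acting on a single flow step `[s, s + h]` — the deterministic one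
(`ExactRestriction`) PROVED in §1b (rev 2, 2026-08-17), the other three registered as stubs — and the
composition `BoundaryWard_of` PROVED here (≈ 200 lines of real analysis + measure theory, no `sorry` outside the
stubs; axioms `propext, Classical.choice, Quot.sound`):

* `ExactRestriction` (PROVED in §1b — was `stub_exactRestriction` in rev 1; deterministic; LSW 2004 §3.4.5, partition-function form already in
  `Literature/…/SAWRestrictionCovariance.lean`): eventually in `δ`, `law (D_s)_δ` is a probability
  measure and `E_{(D_{s+h})_δ}[f] · P_{(D_s)_δ}(Conf) = E_{(D_s)_δ}[f; Conf]`, `Conf` = "the walk of `(D_s)_δ`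
  has the support of a walk of `(D_{s+h})_δ`" (flow semigroup + largest-component bookkeeping);
* `stub_stripAvoidance` (open boundary estimate): `P_{(D_s)_δ}(Confᶜ) ≤ L h` eventually, `L, h₀` uniform
  along the orbit (continuum value `1 − |g₋ₕ′(a) g₋ₕ′(b)|^{5/8} = O(h)`);
* `stub_collarTouching` (THE HARD CORE, open — Cardy's boundary condition "bulk stress tensor at the
  boundary = touching density", lattice form): `|Cov_{(D_s)_δ}(f, 1_{Confᶜ}) + h C(s, δ)| ≤ η h`
  eventually, for `h ≤ h₀(η)` uniformly in `s`;
* `stub_responseContinuity` (open, soft): `|h C(s, δ) − ∫ₛ^{s+h} C(r, δ) dr| ≤ η h` eventually, for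
  `h ≤ h₀(η)` uniformly in `s` (cumulative form: interval integrability of `C(·, δ)` is part of it).

PROOF of the composition: exact restriction gives `ΔF + Θ = ΔF · q` with `q = P(Confᶜ)`,
`Θ = Cov(f, 1_{Confᶜ})`, `|Θ| ≤ 2‖f‖ q` (`abs_setIntegral_sub_mul_le`), hence `|ΔF| ≤ 4‖f‖ q` and
`|ΔF + Θ| ≤ 4‖f‖ q² ≤ 4‖f‖ L² h²`; with the last two stubs the one-step error is `≤ 3ηh` once
`h ≤ h₀(η)` (`abs_step_le`); chop `[0, t]` into `n` equal steps, intersect the `4n` eventualities in `δ`,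
telescope (`Finset.sum_range_sub`): `|E_{(D_t)_δ}[f] − E_{D_δ}[f] − ∫₀ᵗ C| ≤ 3ηt` eventually for every
`η > 0` (`tendsto_of_uniform_steps`); `g₀ = id` identifies `D₀ = D`. The interior Ward hypothesis of the
crux is only threaded through to stubs 3–4. The statements `ExactRestriction`, …, `ResponseContinuity`
(§1) are the bodies filed as the route's children in `children.json` (split ready-to-run; `route edit
--split` is final-cycle-only for this seat); `boundaryWard_of_subs` is the same glue in the inline form a
prover lands as `Theorems/SAWQuadrupoleWardBoundaryWardSplit.lean` for `--glue-by`.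

Disproof used: none (no `Cruxes/BoundaryWard/Disproof.lean` exists at registration). Dead lines: none
registered for this crux. Which stub is load-bearing: `stub_collarTouching`.
-/

/-! ## 1b. `ExactRestriction` PROVED (flow nesting by ODE uniqueness, walk nesting, restriction identity) -/

namespace Summit.CriticalPhenomena.SAWScalingLimit.Cruxes.BoundaryWard.ExactRestrictionProof

open MeasureTheory Filter Set
open scoped Topology ENNReal
open Literature.Probability.LatticeModels Literature.Probability.RandomPlanarGeometry
open Literature.Probability.RandomPlanarGeometry.SAW
open Summit.CriticalPhenomena.SAWScalingLimit.Theorems.ScreeningRecursion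

/-! ## Walk nesting -/

/-- A walk of `Ω'_δ` starting in the discrete domain `Ω_δ ⊇` (as sets `Ω' ⊆ Ω`) is, with the same
support, a walk of `Ω_δ`. [folklore] -/
theorem exists_walk_support_eq_of_subset {Ω Ω' : Set ℂ} {δ : ℝ} (hsub : Ω' ⊆ Ω) {v w : Site 2}
    (p : (discreteDomainGraph Ω' δ).Walk v w) (hv : v ∈ meshDomain Ω δ) :
    ∃ q : (discreteDomainGraph Ω δ).Walk v w, q.support = p.support := by
  induction p with
  | nil => exact ⟨SimpleGraph.Walk.nil, rfl⟩
  | @cons v v₁ w hadj p ih =>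
    obtain ⟨hmesh', -, hv₁D'⟩ := discreteDomainGraph_adj_iff.1 hadj
    obtain ⟨hzd, hseg⟩ := meshGraph_adj_iff.1 hmesh'
    have hmesh : (meshGraph Ω δ).Adj v v₁ :=
      meshGraph_adj_iff.2 ⟨hzd, hseg.trans (closure_mono hsub)⟩
    have hvV : v ∈ meshVertices Ω δ := meshDomain_subset_meshVertices _ _ hv
    have hv₁V : v₁ ∈ meshVertices Ω δ := by
      have h := meshDomain_subset_meshVertices _ _ hv₁D'
      rw [mem_meshVertices_iff] at h ⊢
      exact hsub h
    have hv₁ : v₁ ∈ meshDomain Ω δ :=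
      mem_meshDomain_of_adj (u := ⟨v, hvV⟩) (w := ⟨v₁, hv₁V⟩) hv
        (by simpa only [SimpleGraph.comap_adj, Function.Embedding.subtype_apply] using hmesh)
    obtain ⟨q, hq⟩ := ih hv₁
    exact ⟨SimpleGraph.Walk.cons (discreteDomainGraph_adj_iff.2 ⟨hmesh, hv, hv₁⟩) q, by
      rw [SimpleGraph.Walk.support_cons, SimpleGraph.Walk.support_cons, hq]⟩

/-- **Walk nesting** (stub R2 of `PieceSkeletons.lean`, PROVED). [folklore] -/
theorem walkNesting :
    ∀ (Ω Ω' : Set ℂ) (δ : ℝ) (x y : Literature.Probability.LatticeModels.Site 2), Ω' ⊆ Ω → (x ∈ Literature.Probability.LatticeModels.meshDomain Ω δ ∨ x = y) → ∀ γ' : Literature.Probability.RandomPlanarGeometry.SAW.DomainSAW Ω' δ x y, ∃ γ : Literature.Probability.RandomPlanarGeometry.SAW.DomainSAW Ω δ x y, γ.walk.support = γ'.walk.support := by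
  intro Ω Ω' δ x y hsub hx γ'
  rcases hx with hx | hxy
  · obtain ⟨q, hq⟩ := exists_walk_support_eq_of_subset hsub γ'.walk hx
    refine ⟨⟨q, ?_⟩, hq⟩
    rw [SimpleGraph.Walk.isPath_def, hq, ← SimpleGraph.Walk.isPath_def]
    exact γ'.isPath
  · subst hxy
    obtain ⟨p, hp⟩ := γ'
    cases p with
    | nil => exact ⟨⟨SimpleGraph.Walk.nil, SimpleGraph.Walk.IsPath.nil⟩, rfl⟩
    | cons hadj q =>
      exfalso
      rw [SimpleGraph.Walk.cons_isPath_iff] at hp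
      exact hp.2 (SimpleGraph.Walk.end_mem_support q)

/-! ## The integral restriction identity -/

/-- **Integral form of exact restriction** (stub R3 of `PieceSkeletons.lean`, PROVED): under walk
nesting, for bounded `Ω`, `δ > 0` and joined endpoints, `law Ω_δ` is a probability measure and
`E_{Ω'}[f] · P_Ω(Conf) = ∫_{Conf} f dP_Ω`. [cite: LawlerSchrammWerner2004SAW, §3.4.5] -/
theorem restrictionIntegral :
    ∀ (Ω Ω' : Set ℂ) (δ : ℝ) (x y : Literature.Probability.LatticeModels.Site 2), Bornology.IsBounded Ω → 0 < δ → (Literature.Probability.LatticeModels.discreteDomainGraph Ω δ).Reachable x y → (∀ γ' : Literature.Probability.RandomPlanarGeometry.SAW.DomainSAW Ω' δ x y, ∃ γ : Literature.Probability.RandomPlanarGeometry.SAW.DomainSAW Ω δ x y, γ.walk.support = γ'.walk.support) → ∀ f : BoundedContinuousFunction (Literature.Probability.RandomPlanarGeometry.CurveClass ℂ) ℝ, MeasureTheory.IsProbabilityMeasure (Literature.Probability.RandomPlanarGeometry.SAW.law Ω δ x y) ∧ (∫ γ, f γ.curve ∂(Literature.Probability.RandomPlanarGeometry.SAW.law Ω'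 δ x y)) * ((Literature.Probability.RandomPlanarGeometry.SAW.law Ω δ x y) {γ | ∃ γ' : Literature.Probability.RandomPlanarGeometry.SAW.DomainSAW Ω' δ x y, γ'.walk.support = γ.walk.support}).toReal = ∫ γ in {γ | ∃ γ' : Literature.Probability.RandomPlanarGeometry.SAW.DomainSAW Ω' δ x y, γ'.walk.support = γ.walk.support}, f γ.curve ∂(Literature.Probability.RandomPlanarGeometry.SAW.law Ω δ x y) := by
  intro Ω Ω' δ x y hbdd hδ hreach hN f
  haveI hprob : IsProbabilityMeasure (law Ω δ x y) :=
    isProbabilityMeasure_law_of_reachable hbdd hδ hreach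
  refine ⟨hprob, ?_⟩
  classical
  -- finiteness of both walk spaces; discrete measurability
  haveI : Finite (DomainSAW Ω δ x y) := SAW.finite_domainSAW hbdd hδ x y
  choose ι hι using hN
  have hN' : ∀ γ' : DomainSAW Ω' δ x y, ∃ γ : DomainSAW Ω δ x y,
      γ.walk.support = γ'.walk.support := fun γ' => ⟨ι γ', hι γ'⟩
  have hιinj : Function.Injective ι := fun γ₁ γ₂ h =>
    DomainSAW.ext_support (by rw [← hι γ₁, ← hι γ₂, h])
  haveI : Finite (DomainSAW Ω' δ x y) := Finite.of_injective ι hιinj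
  letI : Fintype (DomainSAW Ω δ x y) := Fintype.ofFinite _
  letI : Fintype (DomainSAW Ω' δ x y) := Fintype.ofFinite _
  haveI : MeasurableSingletonClass (DomainSAW Ω δ x y) :=
    ⟨fun _ => MeasurableSpace.measurableSet_top⟩
  haveI : MeasurableSingletonClass (DomainSAW Ω' δ x y) :=
    ⟨fun _ => MeasurableSpace.measurableSet_top⟩
  haveI : IsFiniteMeasure (law Ω' δ x y) :=
    ⟨(law_apply_le_one _).trans_lt ENNReal.one_lt_top⟩
  -- partition functions
  set Z := weight Ω δ x y univ with hZ
  set Z' := weight Ω' δ x y univ with hZ'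
  have hZtop : Z ≠ ⊤ := weight_univ_ne_top hbdd hδ x y
  have hZ'le : Z' ≤ Z := weight_univ_le_weight_univ hN'
  have hZ'top : Z' ≠ ⊤ := ne_top_of_le_ne_top hZtop hZ'le
  -- the confinement event is the range of ι
  set Cf : Set (DomainSAW Ω δ x y) :=
    {γ | ∃ γ' : DomainSAW Ω' δ x y, γ'.walk.support = γ.walk.support} with hCf
  have hCflaw : law Ω δ x y Cf = Z⁻¹ * Z' := law_setOf_exists_support_eq_eq hN'
  have hmemCf : ∀ γ, γ ∈ Cf ↔ ∃ γ', ι γ' = γ := by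
    intro γ
    constructor
    · rintro ⟨γ', h⟩
      exact ⟨γ', DomainSAW.ext_support (by rw [hι γ', h])⟩
    · rintro ⟨γ', rfl⟩
      exact ⟨γ', (hι γ').symm⟩
  -- curves and lengths agree along ι
  have hcurve : ∀ γ', (ι γ').curve = γ'.curve := by
    intro γ'
    show CurveClass.mk _ = CurveClass.mk _
    rw [DomainSAW.toCurve_eq_of_support_eq (hι γ')]
  have hlen : ∀ γ', (ι γ').length = γ'.length := fun γ' =>
    DomainSAW.length_eq_of_support_eq (hι γ')
  -- point masses
  have hptΩ : ∀ γ : DomainSAW Ω δ x y,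
      law Ω δ x y {γ} = Z⁻¹ * ENNReal.ofReal (criticalFugacity ^ γ.length) := fun γ => by
    rw [law_apply_eq_inv_mul_weight, weight_singleton]
  have hptΩ' : ∀ γ' : DomainSAW Ω' δ x y,
      law Ω' δ x y {γ'} = Z'⁻¹ * ENNReal.ofReal (criticalFugacity ^ γ'.length) := fun γ' => by
    rw [law_apply_eq_inv_mul_weight, weight_singleton]
  -- both integrals as finite sums
  have hI' : ∫ γ', f γ'.curve ∂(law Ω' δ x y) =
      ∑ γ', (law Ω' δ x y {γ'}).toReal * f γ'.curve := by
    rw [integral_fintype Integrable.of_finite]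
    simp only [smul_eq_mul, measureReal_def]
  have hI : ∫ γ in Cf, f γ.curve ∂(law Ω δ x y) =
      ∑ γ, ((law Ω δ x y).restrict Cf {γ}).toReal * f γ.curve := by
    rw [integral_fintype Integrable.of_finite]
    simp only [smul_eq_mul, measureReal_def]
  rw [hI', hI, hCflaw]
  -- restrict to the range of ι
  have hrestr : ∀ γ, ((law Ω δ x y).restrict Cf {γ}).toReal * f γ.curve =
      if γ ∈ Cf then (law Ω δ x y {γ}).toReal * f γ.curve else 0 := by
    intro γ
    rw [Measure.restrict_apply (MeasurableSpace.measurableSet_top)]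
    by_cases h : γ ∈ Cf
    · rw [if_pos h, Set.inter_eq_left.2 (Set.singleton_subset_iff.2 h)]
    · rw [if_neg h, Set.singleton_inter_eq_empty.2 h, measure_empty, ENNReal.toReal_zero,
        zero_mul]
  simp_rw [hrestr]
  rw [← Finset.sum_filter]
  have hfilter : (Finset.univ.filter fun γ => γ ∈ Cf) = Finset.univ.image ι := by
    ext γ
    simp only [Finset.mem_filter, Finset.mem_univ, true_and, Finset.mem_image, hmemCf]
  rw [hfilter, Finset.sum_image (fun γ₁ _ γ₂ _ h => hιinj h), Finset.sum_mul]
  refine Finset.sum_congr rfl fun γ' _ => ?_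
  rw [hptΩ', hptΩ, hlen, hcurve]
  -- the scalar identity `(Z'⁻¹ w) · (Z⁻¹ Z') = Z⁻¹ w` (or both sides `0` when `Z' = 0`)
  rcases eq_or_ne Z' 0 with hZ'0 | hZ'0
  · -- then the small walk space is empty: `γ'` cannot exist
    exfalso
    have h1 : weight Ω' δ x y {γ'} ≤ Z' := measure_mono (subset_univ _)
    rw [hZ'0, weight_singleton, nonpos_iff_eq_zero, ENNReal.ofReal_eq_zero] at h1
    exact absurd h1 (not_le.2 (pow_pos criticalFugacity_pos_lt_one'.1 _))
  · have key : Z'⁻¹ * ENNReal.ofReal (criticalFugacity ^ γ'.length) * (Z⁻¹ * Z') =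
        Z⁻¹ * ENNReal.ofReal (criticalFugacity ^ γ'.length) := by
      calc Z'⁻¹ * ENNReal.ofReal (criticalFugacity ^ γ'.length) * (Z⁻¹ * Z')
          = Z⁻¹ * ENNReal.ofReal (criticalFugacity ^ γ'.length) * (Z'⁻¹ * Z') := by ring
        _ = Z⁻¹ * ENNReal.ofReal (criticalFugacity ^ γ'.length) := by
            rw [ENNReal.inv_mul_cancel hZ'0 hZ'top, mul_one]
    calc (Z'⁻¹ * ENNReal.ofReal (criticalFugacity ^ γ'.length)).toReal * f γ'.curve *
          (Z⁻¹ * Z').toReal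
        = (Z'⁻¹ * ENNReal.ofReal (criticalFugacity ^ γ'.length) * (Z⁻¹ * Z')).toReal *
            f γ'.curve := by simp only [ENNReal.toReal_mul]; ring
      _ = (Z⁻¹ * ENNReal.ofReal (criticalFugacity ^ γ'.length)).toReal * f γ'.curve := by
            rw [key]

end Summit.CriticalPhenomena.SAWScalingLimit.Cruxes.BoundaryWard.ExactRestrictionProof

namespace Summit.CriticalPhenomena.SAWScalingLimit.Cruxes.BoundaryWard.ExactRestrictionProof

open MeasureTheory Filter Set
open scoped Topology ENNReal NNReal
open Literature.Probability.LatticeModels Literature.Probability.RandomPlanarGeometry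
open Literature.Probability.RandomPlanarGeometry.SAW

/-! ## Flow nesting (ODE uniqueness) -/

/-- A `C¹` vector field is Lipschitz on every closed ball. [folklore] -/
theorem exists_lipschitzOnWith_closedBall {u : ℂ → ℂ} (huc : ContDiff ℝ 2 u) (R : ℝ) :
    ∃ K : ℝ≥0, LipschitzOnWith K u (Metric.closedBall 0 R) := by
  have hcont : Continuous (fderiv ℝ u) := huc.continuous_fderiv (by norm_num)
  obtain ⟨C, hC⟩ := (isCompact_closedBall (0:ℂ) R).exists_bound_of_continuousOn hcont.continuousOn
  refine ⟨Real.toNNReal C, ?_⟩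
  refine Convex.lipschitzOnWith_of_nnnorm_fderiv_le (𝕜 := ℝ)
    (fun x _ => (huc.differentiable (by norm_num)).differentiableAt) (fun x hx => ?_)
    (convex_closedBall 0 R)
  have h := hC x hx
  rw [← NNReal.coe_le_coe, coe_nnnorm]
  exact h.trans (Real.le_coe_toNNReal C)

/-- **Flow nesting** (stub R1 of `PieceSkeletons.lean`, PROVED): the flow of a `C²` field on `D̄`
mapping `D` into itself satisfies `g_{s+h}(z) = g_s(g_h(z))` for `z ∈ D` (uniqueness of solutions,
`u` being Lipschitz on a ball containing the bounded `D`), hence `g_{s+h}(D) ⊆ g_s(D)`. [folklore] -/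
theorem flowNesting :
    ∀ (D : Literature.Probability.RandomPlanarGeometry.DobrushinDomain) (u : ℂ → ℂ), ContDiff ℝ 2 u → ∀ (g : ℝ → ℂ → ℂ) (t₀ : ℝ), 0 < t₀ → (∀ z, g 0 z = z) → (∀ t ∈ Set.Icc (0 : ℝ) t₀, ∀ z ∈ closure D.carrier, HasDerivAt (fun r => g r z) (u (g t z)) t) → (∀ t ∈ Set.Icc (0 : ℝ) t₀, g t '' D.carrier ⊆ D.carrier) → ∀ s h : ℝ, 0 ≤ s → 0 ≤ h → s + h ≤ t₀ → g (s + h) '' D.carrier ⊆ g s '' D.carrier := by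
  intro D u huc g t₀ ht₀ hg0 hgd hgD s h hs hh hsh
  rintro _ ⟨z, hz, rfl⟩
  -- the ball containing `D`
  obtain ⟨R, hR⟩ := (Metric.isBounded_iff_subset_closedBall (0:ℂ)).1 D.isBounded
  obtain ⟨K, hK⟩ := exists_lipschitzOnWith_closedBall huc R
  have hgDmem : ∀ t ∈ Set.Icc (0:ℝ) t₀, ∀ w ∈ D.carrier, g t w ∈ D.carrier :=
    fun t ht w hw => hgD t ht ⟨w, hw, rfl⟩
  -- the two trajectories from `g h z`
  set φ₁ : ℝ → ℂ := fun r => g (h + r) z with hφ₁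
  set φ₂ : ℝ → ℂ := fun r => g r (g h z) with hφ₂
  have hhz : g h z ∈ D.carrier := hgDmem h ⟨hh, by linarith⟩ z hz
  have hd₁ : ∀ r ∈ Set.Icc (0:ℝ) s, HasDerivAt φ₁ (u (φ₁ r)) r := by
    intro r hr
    have hmem : h + r ∈ Set.Icc (0:ℝ) t₀ := ⟨by linarith [hr.1], by linarith [hr.2]⟩
    exact (hgd (h + r) hmem z (subset_closure hz)).comp_const_add h r
  have hd₂ : ∀ r ∈ Set.Icc (0:ℝ) s, HasDerivAt φ₂ (u (φ₂ r)) r := by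
    intro r hr
    exact hgd r ⟨hr.1, by linarith [hr.2]⟩ (g h z) (subset_closure hhz)
  have heq : EqOn φ₁ φ₂ (Set.Icc 0 s) := by
    refine ODE_solution_unique_of_mem_Icc_right (v := fun _ => u) (s := fun _ => Metric.closedBall 0 R)
      (K := K) (fun _ _ => hK)
      (fun r hr => (hd₁ r hr).continuousAt.continuousWithinAt)
      (fun r hr => (hd₁ r (Ico_subset_Icc_self hr)).hasDerivWithinAt)
      (fun r hr => hR (hgDmem (h + r) ⟨by linarith [hr.1], by linarith [hr.2]⟩ z hz))
      (fun r hr => (hd₂ r hr).continuousAt.continuousWithinAt)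
      (fun r hr => (hd₂ r (Ico_subset_Icc_self hr)).hasDerivWithinAt)
      (fun r hr => hR (hgDmem r ⟨hr.1, by linarith [hr.2]⟩ (g h z) hhz)) ?_
    show g (h + 0) z = g 0 (g h z)
    rw [add_zero, hg0]
  have key : g (s + h) z = g s (g h z) := by
    have := heq ⟨hs, le_rfl⟩
    simp only [hφ₁, hφ₂] at this
    rw [add_comm] at this
    exact this
  exact ⟨g h z, hhz, key.symm⟩

end Summit.CriticalPhenomena.SAWScalingLimit.Cruxes.BoundaryWard.ExactRestrictionProof

namespace Summit.CriticalPhenomena.SAWScalingLimit.Cruxes.BoundaryWard.ExactRestrictionProof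

open MeasureTheory Filter Set
open scoped Topology ENNReal
open Literature.Probability.LatticeModels Literature.Probability.RandomPlanarGeometry
open Literature.Probability.RandomPlanarGeometry.SAW

/-- Joined endpoints: either the start lies in the discrete domain or the two endpoints coincide.
[folklore] -/
theorem mem_meshDomain_or_eq_of_reachable {Ω : Set ℂ} {δ : ℝ} {x y : Site 2}
    (h : (discreteDomainGraph Ω δ).Reachable x y) : x ∈ meshDomain Ω δ ∨ x = y := by
  obtain ⟨p⟩ := h
  cases p with
  | nil => exact Or.inr rfl
  | cons hadj _ => exact Or.inl (discreteDomainGraph_adj_iff.1 hadj).2.1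

/-- **`ExactRestriction` (the support child of the split of `BoundaryWard`), PROVED.**
[cite: LawlerSchrammWerner2004SAW, §3.4.5] -/
theorem exactRestriction :
    ∀ (D : Literature.Probability.RandomPlanarGeometry.DobrushinDomain) (a b : ℝ → Literature.Probability.LatticeModels.Site 2), Literature.Probability.RandomPlanarGeometry.SAW.IsEndpointApprox D a b → let P := fun (Ω : Set ℂ) (δ : ℝ) => Literature.Probability.RandomPlanarGeometry.SAW.law Ω δ (a δ) (b δ); ∀ (u : ℂ → ℂ) (U : Set ℂ), IsOpen U → closure D.carrier ⊆ U → DifferentiableOn ℂ u U → ContDiff ℝ 2 u → u (D.pt 0) = 0 → u (D.pt 1) = 0 → ∀ (g : ℝ → ℂ → ℂ) (hg : ∀ t, Continuous (g t)) (t₀ : ℝ), 0 < t₀ → (∀ z, g 0 z = z) → (∀ t, ∃ K, LipschitzWith K (g t)) → (∀ t ∈ Set.Icc (0 : ℝ) t₀, ∀ z ∈ closure D.carrier, HasDerivAt (fun r => g r z) (u (g t z)) t) → (∀ t ∈ Set.Icc (0 : ℝ) t₀, g t '' D.carrier ⊆ D.carrier) → (∀ t ∈ Set.Icc (0 : ℝ)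 t₀, ∀ᶠ δ in nhdsWithin 0 (Set.Ioi 0), (Literature.Probability.LatticeModels.discreteDomainGraph (g t '' D.carrier) δ).Reachable (a δ) (b δ)) → ∀ f : BoundedContinuousFunction (Literature.Probability.RandomPlanarGeometry.CurveClass ℂ) ℝ, ∀ s ∈ Set.Icc (0 : ℝ) t₀, ∀ h : ℝ, 0 < h → s + h ≤ t₀ → ∀ᶠ δ in nhdsWithin 0 (Set.Ioi 0), MeasureTheory.IsProbabilityMeasure (P (g s '' D.carrier) δ) ∧ (∫ γ, f γ.curve ∂(P (g (s + h) '' D.carrier) δ)) * ((P (g s '' D.carrier) δ) {γ | ∃ γ' : Literature.Probability.RandomPlanarGeometry.SAW.DomainSAW (g (s + h) '' D.carrier) δ (a δ) (b δ), γ'.walk.support = γ.walk.support}).toReal = ∫ γ in {γ | ∃ γ' : Literature.Probability.RandomPlanarGeometry.SAW.DomainSAW (g (s + h) '' D.carrier) δ (a δ) (b δ), γ'.walk.support = γ.walk.support}, f γ.curve ∂(P (g s '' D.carrier) δ) := by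
  intro D a b hab P u U hU hDU hud huc hua hub g hg t₀ ht₀ hg0 hgL hgd hgD hreach f s hs h hh hsh
  have hnest : g (s + h) '' D.carrier ⊆ g s '' D.carrier :=
    flowNesting D u huc g t₀ ht₀ hg0 hgd hgD s h hs.1 hh.le hsh
  have hbdd : Bornology.IsBounded (g s '' D.carrier) := D.isBounded.subset (hgD s hs)
  filter_upwards [hreach s hs, self_mem_nhdsWithin] with δ hr hδ
  have hN := walkNesting (g s '' D.carrier) (g (s + h) '' D.carrier) δ (a δ) (b δ) hnest
    (mem_meshDomain_or_eq_of_reachable hr)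
  exact restrictionIntegral (g s '' D.carrier) (g (s + h) '' D.carrier) δ (a δ) (b δ) hbdd hδ hr hN f

end Summit.CriticalPhenomena.SAWScalingLimit.Cruxes.BoundaryWard.ExactRestrictionProof

namespace Summit.CriticalPhenomena.SAWScalingLimit.Cruxes.BoundaryWard.CollarStepTelescoping

/-! ## 1. The statements of the line (closed terms over landed declarations; = the split's children) -/

/-- (R) Exact lattice restriction along the flow, integral form (deterministic). [cite: LawlerSchrammWerner2004SAW, §3.4.5] -/
def ExactRestriction : Prop :=
  ∀ (D : Literature.Probability.RandomPlanarGeometry.DobrushinDomain) (a b : ℝ → Literature.Probability.LatticeModels.Site 2), Literature.Probability.RandomPlanarGeometry.SAW.IsEndpointApprox D a b → let P := fun (Ω : Set ℂ) (δ : ℝ) => Literature.Probability.RandomPlanarGeometry.SAW.law Ω δ (a δ) (b δ); ∀ (u : ℂ → ℂ) (U : Set ℂ), IsOpen U → closure D.carrier ⊆ U → DifferentiableOn ℂ u U → ContDiff ℝ 2 u → u (D.pt 0) = 0 → u (D.pt 1) = 0 → ∀ (g : ℝ → ℂ → ℂ) (hg : ∀ t, Continuous (g t)) (t₀ : ℝ),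 0 < t₀ → (∀ z, g 0 z = z) → (∀ t, ∃ K, LipschitzWith K (g t)) → (∀ t ∈ Set.Icc (0 : ℝ) t₀, ∀ z ∈ closure D.carrier, HasDerivAt (fun r => g r z) (u (g t z)) t) → (∀ t ∈ Set.Icc (0 : ℝ) t₀, g t '' D.carrier ⊆ D.carrier) → (∀ t ∈ Set.Icc (0 : ℝ) t₀, ∀ᶠ δ in nhdsWithin 0 (Set.Ioi 0), (Literature.Probability.LatticeModels.discreteDomainGraph (g t '' D.carrier) δ).Reachable (a δ) (b δ)) → ∀ f : BoundedContinuousFunction (Literature.Probability.RandomPlanarGeometry.CurveClass ℂ) ℝ, ∀ s ∈ Set.Icc (0 : ℝ) t₀, ∀ h : ℝ, 0 < h → s + h ≤ t₀ → ∀ᶠ δ in nhdsWithin 0 (Set.Ioi 0), MeasureTheory.IsProbabilityMeasure (P (g s '' D.carrier) δ) ∧ (∫ γ, f γ.curve ∂(P (g (s + h) '' D.carrier) δ)) * ((P (g s '' D.carrier) δ) {γ | ∃ γ' : Literature.Probability.RandomPlanarGeometry.SAW.DomainSAW (g (s + h) '' D.carrier) δ (a δ) (b δ), γ'.walk.support =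 γ.walk.support}).toReal = ∫ γ in {γ | ∃ γ' : Literature.Probability.RandomPlanarGeometry.SAW.DomainSAW (g (s + h) '' D.carrier) δ (a δ) (b δ), γ'.walk.support = γ.walk.support}, f γ.curve ∂(P (g s '' D.carrier) δ)

/-- (V) Strip avoidance: the walk of `(D_s)_δ` leaves `(D_{s+h})_δ` with probability `O(h)`. [folklore] -/
def StripAvoidance : Prop :=
  ∀ (D : Literature.Probability.RandomPlanarGeometry.DobrushinDomain) (a b : ℝ → Literature.Probability.LatticeModels.Site 2), Literature.Probability.RandomPlanarGeometry.SAW.IsEndpointApprox D a b → let P := fun (Ω : Set ℂ) (δ : ℝ) => Literature.Probability.RandomPlanarGeometry.SAW.law Ω δ (a δ) (b δ); ∀ (u : ℂ → ℂ) (U : Set ℂ), IsOpen U → closure D.carrier ⊆ U → DifferentiableOn ℂ u U → ContDiff ℝ 2 u → u (D.pt 0) = 0 → u (D.pt 1) = 0 → ∀ (g : ℝ → ℂ → ℂ) (hg : ∀ t, Continuous (g t)) (t₀ : ℝ), 0 < t₀ → (∀ z, g 0 z = z) → (∀ t, ∃ K, LipschitzWith K (g t)) → (∀ t ∈ Set.Icc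 (0 : ℝ) t₀, ∀ z ∈ closure D.carrier, HasDerivAt (fun r => g r z) (u (g t z)) t) → (∀ t ∈ Set.Icc (0 : ℝ) t₀, g t '' D.carrier ⊆ D.carrier) → (∀ t ∈ Set.Icc (0 : ℝ) t₀, ∀ᶠ δ in nhdsWithin 0 (Set.Ioi 0), (Literature.Probability.LatticeModels.discreteDomainGraph (g t '' D.carrier) δ).Reachable (a δ) (b δ)) → ∃ L : ℝ, ∃ h₀ : ℝ, 0 < h₀ ∧ ∀ s ∈ Set.Icc (0 : ℝ) t₀, ∀ h ∈ Set.Ioc (0 : ℝ) h₀, s + h ≤ t₀ → ∀ᶠ δ in nhdsWithin 0 (Set.Ioi 0), ((P (g s '' D.carrier) δ) {γ | ∃ γ' : Literature.Probability.RandomPlanarGeometry.SAW.DomainSAW (g (s + h) '' D.carrier) δ (a δ) (b δ), γ'.walk.support = γ.walk.support}ᶜ).toReal ≤ L * h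

/-- (P2) Collar covariance `= −` strip-touching covariance to first order (the hard core). [folklore] -/
def CollarTouching : Prop :=
  ∀ κ₁ κ₂ : ℝ → ℝ, (∀ (D : Literature.Probability.RandomPlanarGeometry.DobrushinDomain) (a b : ℝ → Literature.Probability.LatticeModels.Site 2), Literature.Probability.RandomPlanarGeometry.SAW.IsEndpointApprox D a b → let P := fun (Ω : Set ℂ) (δ : ℝ) => Literature.Probability.RandomPlanarGeometry.SAW.law Ω δ (a δ) (b δ); ∀ (v : ℂ → ℂ), ContDiff ℝ 2 v → tsupport v ⊆ D.carrier → ∀ (φ : ℝ → ℂ → ℂ) (hφ : ∀ t, Continuous (φ t)), (∀ z, φ 0 z = z) → (∀ t z, HasDerivAt (fun r => φ r z) (v (φ t z)) t) → ∀ f : BoundedContinuousFunction (Literature.Probability.RandomPlanarGeometry.CurveClass ℂ) ℝ, let strain : (ℂ → ℂ) → ℂ → ℂ := fun w z => fderiv ℝ w z 1 + Complex.I * fderiv ℝ w z Complex.I; let quad : ℝ → (ℂ → ℂ) → List (Literature.Probability.LatticeModels.Site 2) → ℝ := fun δ s xs => let l := xs.map (Literature.Probability.LatticeModels.meshPoint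 δ); κ₁ δ * (List.zipWith (fun p q : ℂ => (s ((p + q) / 2)).re * (((q - p).re) ^ 2 - ((q - p).im) ^ 2) / δ ^ 2) l l.tail).sum + κ₂ δ * (List.zipWith3 (fun p q r : ℂ => (s q).im * ((r - p).re * (r - p).im) / δ ^ 2) l l.tail l.tail.tail).sum; let fbar : Literature.Probability.RandomPlanarGeometry.CurveClass ℂ → ℝ := fun c => ∫ t in (0 : ℝ)..1, f (Literature.Probability.RandomPlanarGeometry.CurveClass.map ⟨φ t, hφ t⟩ c); Filter.Tendsto (fun δ : ℝ => (∫ γ, f (Literature.Probability.RandomPlanarGeometry.CurveClass.map ⟨φ 1, hφ 1⟩ γ.curve) ∂(P D.carrier δ)) - (∫ γ, f γ.curve ∂(P D.carrier δ)) - ((∫ γ, fbar γ.curve * quad δ (strain v) γ.walk.support ∂(P D.carrier δ)) - (∫ γ, fbar γ.curve ∂(P D.carrier δ)) * (∫ γ, quad δ (strain v) γ.walk.support ∂(P D.carrier δ)))) (nhdsWithin 0 (Set.Ioi 0)) (nhds 0)) → ∀ (D : Literature.Probability.RandomPlanarGeometry.DobrushinDomain) (a b : ℝ → Literature.Probability.LatticeModels.Site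 2), Literature.Probability.RandomPlanarGeometry.SAW.IsEndpointApprox D a b → let P := fun (Ω : Set ℂ) (δ : ℝ) => Literature.Probability.RandomPlanarGeometry.SAW.law Ω δ (a δ) (b δ); ∀ (u : ℂ → ℂ) (U : Set ℂ), IsOpen U → closure D.carrier ⊆ U → DifferentiableOn ℂ u U → ContDiff ℝ 2 u → u (D.pt 0) = 0 → u (D.pt 1) = 0 → ∀ (g : ℝ → ℂ → ℂ) (hg : ∀ t, Continuous (g t)) (t₀ : ℝ), 0 < t₀ → (∀ z, g 0 z = z) → (∀ t, ∃ K, LipschitzWith K (g t)) → (∀ t ∈ Set.Icc (0 : ℝ) t₀, ∀ z ∈ closure D.carrier, HasDerivAt (fun r => g r z) (u (g t z)) t) → (∀ t ∈ Set.Icc (0 : ℝ) t₀, g t '' D.carrier ⊆ D.carrier) → (∀ t ∈ Set.Icc (0 : ℝ) t₀, ∀ᶠ δ in nhdsWithin 0 (Set.Ioi 0), (Literature.Probability.LatticeModels.discreteDomainGraph (g t '' D.carrier) δ).Reachable (a δ) (b δ)) → ∀ (K : Set ℂ), IsCompact K → K ⊆ g t₀ '' D.carrier → ∀ (χ : ℂ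 → ℝ), ContDiff ℝ 2 χ → (∀ᶠ z in nhdsSet K, χ z = 1) → tsupport χ ⊆ g t₀ '' D.carrier → ∀ f : BoundedContinuousFunction (Literature.Probability.RandomPlanarGeometry.CurveClass ℂ) ℝ, (∀ ψ : ℂ ≃ₜ ℂ, (∀ z ∈ K, ψ z = z) → ∀ c, f (Literature.Probability.RandomPlanarGeometry.CurveClass.map (ψ : C(ℂ, ℂ)) c) = f c) → ∀ η : ℝ, 0 < η → ∃ h₀ : ℝ, 0 < h₀ ∧ ∀ s ∈ Set.Icc (0 : ℝ) t₀, ∀ h ∈ Set.Ioc (0 : ℝ) h₀, s + h ≤ t₀ → let strain : (ℂ → ℂ) → ℂ → ℂ := fun w z => fderiv ℝ w z 1 + Complex.I * fderiv ℝ w z Complex.I; let quad : ℝ → (ℂ → ℂ) → List (Literature.Probability.LatticeModels.Site 2) → ℝ := fun δ s xs => let l := xs.map (Literature.Probability.LatticeModels.meshPoint δ); κ₁ δ * (List.zipWith (fun p q : ℂ => (s ((p + q) / 2)).re * (((q - p).re) ^ 2 - ((q - p).im) ^ 2) / δ ^ 2) l l.tail).sum + κ₂ δ * (List.zipWith3 (fun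 p q r : ℂ => (s q).im * ((r - p).re * (r - p).im) / δ ^ 2) l l.tail l.tail.tail).sum; let v : ℂ → ℂ := fun z => (χ z : ℂ) * u z; ∀ᶠ δ in nhdsWithin 0 (Set.Ioi 0), |((∫ γ in {γ | ∃ γ' : Literature.Probability.RandomPlanarGeometry.SAW.DomainSAW (g (s + h) '' D.carrier) δ (a δ) (b δ), γ'.walk.support = γ.walk.support}ᶜ, f γ.curve ∂(P (g s '' D.carrier) δ)) - (∫ γ, f γ.curve ∂(P (g s '' D.carrier) δ)) * ((P (g s '' D.carrier) δ) {γ | ∃ γ' : Literature.Probability.RandomPlanarGeometry.SAW.DomainSAW (g (s + h) '' D.carrier) δ (a δ) (b δ), γ'.walk.support = γ.walk.support}ᶜ).toReal) + h * ((∫ γ, f γ.curve * quad δ (strain v) γ.walk.support ∂(P (g s '' D.carrier) δ)) - (∫ γ, f γ.curve ∂(P (g s '' D.carrier) δ)) * (∫ γ, quad δ (strain v) γ.walk.support ∂(P (g s '' D.carrier) δ)))| ≤ η * h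

/-- (C) Equicontinuity of the collar response along the orbit (cumulative form). [folklore] -/
def ResponseContinuity : Prop :=
  ∀ κ₁ κ₂ : ℝ → ℝ, (∀ (D : Literature.Probability.RandomPlanarGeometry.DobrushinDomain) (a b : ℝ → Literature.Probability.LatticeModels.Site 2), Literature.Probability.RandomPlanarGeometry.SAW.IsEndpointApprox D a b → let P := fun (Ω : Set ℂ) (δ : ℝ) => Literature.Probability.RandomPlanarGeometry.SAW.law Ω δ (a δ) (b δ); ∀ (v : ℂ → ℂ), ContDiff ℝ 2 v → tsupport v ⊆ D.carrier → ∀ (φ : ℝ → ℂ → ℂ) (hφ : ∀ t, Continuous (φ t)), (∀ z, φ 0 z = z) → (∀ t z, HasDerivAt (fun r => φ r z) (v (φ t z)) t) → ∀ f : BoundedContinuousFunction (Literature.Probability.RandomPlanarGeometry.CurveClass ℂ) ℝ, let strain : (ℂ → ℂ) → ℂ → ℂ := fun w z => fderiv ℝ w z 1 + Complex.I * fderiv ℝ w z Complex.I; let quad : ℝ → (ℂ → ℂ) → List (Literature.Probability.LatticeModels.Site 2) → ℝ := fun δ s xs => let l := xs.map (Literature.Probability.LatticeModels.meshPoint δ);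 κ₁ δ * (List.zipWith (fun p q : ℂ => (s ((p + q) / 2)).re * (((q - p).re) ^ 2 - ((q - p).im) ^ 2) / δ ^ 2) l l.tail).sum + κ₂ δ * (List.zipWith3 (fun p q r : ℂ => (s q).im * ((r - p).re * (r - p).im) / δ ^ 2) l l.tail l.tail.tail).sum; let fbar : Literature.Probability.RandomPlanarGeometry.CurveClass ℂ → ℝ := fun c => ∫ t in (0 : ℝ)..1, f (Literature.Probability.RandomPlanarGeometry.CurveClass.map ⟨φ t, hφ t⟩ c); Filter.Tendsto (fun δ : ℝ => (∫ γ, f (Literature.Probability.RandomPlanarGeometry.CurveClass.map ⟨φ 1, hφ 1⟩ γ.curve) ∂(P D.carrier δ)) - (∫ γ, f γ.curve ∂(P D.carrier δ)) - ((∫ γ, fbar γ.curve * quad δ (strain v) γ.walk.support ∂(P D.carrier δ)) - (∫ γ, fbar γ.curve ∂(P D.carrier δ)) * (∫ γ, quad δ (strain v) γ.walk.support ∂(P D.carrier δ)))) (nhdsWithin 0 (Set.Ioi 0)) (nhds 0)) → ∀ (D : Literature.Probability.RandomPlanarGeometry.DobrushinDomain) (a b : ℝ → Literature.Probability.LatticeModels.Site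 2), Literature.Probability.RandomPlanarGeometry.SAW.IsEndpointApprox D a b → let P := fun (Ω : Set ℂ) (δ : ℝ) => Literature.Probability.RandomPlanarGeometry.SAW.law Ω δ (a δ) (b δ); ∀ (u : ℂ → ℂ) (U : Set ℂ), IsOpen U → closure D.carrier ⊆ U → DifferentiableOn ℂ u U → ContDiff ℝ 2 u → u (D.pt 0) = 0 → u (D.pt 1) = 0 → ∀ (g : ℝ → ℂ → ℂ) (hg : ∀ t, Continuous (g t)) (t₀ : ℝ), 0 < t₀ → (∀ z, g 0 z = z) → (∀ t, ∃ K, LipschitzWith K (g t)) → (∀ t ∈ Set.Icc (0 : ℝ) t₀, ∀ z ∈ closure D.carrier, HasDerivAt (fun r => g r z) (u (g t z)) t) → (∀ t ∈ Set.Icc (0 : ℝ) t₀, g t '' D.carrier ⊆ D.carrier) → (∀ t ∈ Set.Icc (0 : ℝ) t₀, ∀ᶠ δ in nhdsWithin 0 (Set.Ioi 0), (Literature.Probability.LatticeModels.discreteDomainGraph (g t '' D.carrier) δ).Reachable (a δ) (b δ)) → ∀ (K : Set ℂ), IsCompact K → K ⊆ g t₀ '' D.carrier → ∀ (χ : ℂ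 → ℝ), ContDiff ℝ 2 χ → (∀ᶠ z in nhdsSet K, χ z = 1) → tsupport χ ⊆ g t₀ '' D.carrier → ∀ f : BoundedContinuousFunction (Literature.Probability.RandomPlanarGeometry.CurveClass ℂ) ℝ, (∀ ψ : ℂ ≃ₜ ℂ, (∀ z ∈ K, ψ z = z) → ∀ c, f (Literature.Probability.RandomPlanarGeometry.CurveClass.map (ψ : C(ℂ, ℂ)) c) = f c) → ∀ η : ℝ, 0 < η → ∃ h₀ : ℝ, 0 < h₀ ∧ ∀ s ∈ Set.Icc (0 : ℝ) t₀, ∀ h ∈ Set.Ioc (0 : ℝ) h₀, s + h ≤ t₀ → let strain : (ℂ → ℂ) → ℂ → ℂ := fun w z => fderiv ℝ w z 1 + Complex.I * fderiv ℝ w z Complex.I; let quad : ℝ → (ℂ → ℂ) → List (Literature.Probability.LatticeModels.Site 2) → ℝ := fun δ s xs => let l := xs.map (Literature.Probability.LatticeModels.meshPoint δ); κ₁ δ * (List.zipWith (fun p q : ℂ => (s ((p + q) / 2)).re * (((q - p).re) ^ 2 - ((q - p).im) ^ 2) / δ ^ 2) l l.tail).sum + κ₂ δ * (List.zipWith3 (fun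 p q r : ℂ => (s q).im * ((r - p).re * (r - p).im) / δ ^ 2) l l.tail l.tail.tail).sum; let v : ℂ → ℂ := fun z => (χ z : ℂ) * u z; let C : ℝ → ℝ → ℝ := fun r δ => ((∫ γ, f γ.curve * quad δ (strain v) γ.walk.support ∂(P (g r '' D.carrier) δ)) - (∫ γ, f γ.curve ∂(P (g r '' D.carrier) δ)) * (∫ γ, quad δ (strain v) γ.walk.support ∂(P (g r '' D.carrier) δ))); ∀ᶠ δ in nhdsWithin 0 (Set.Ioi 0), |h * C s δ - ((∫ r in (0 : ℝ)..(s + h), C r δ) - (∫ r in (0 : ℝ)..s, C r δ))| ≤ η * h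

/-! ## 2. Registered stubs (sorried; statements LITERAL) and their name-keyed aliases -/

namespace Registered

/-- alias of stub 2's statement. [folklore] -/
abbrev stub_stripAvoidance : Prop := StripAvoidance
/-- alias of stub 3's statement. [folklore] -/
abbrev stub_collarTouching : Prop := CollarTouching
/-- alias of stub 4's statement. [folklore] -/
abbrev stub_responseContinuity : Prop := ResponseContinuity

end Registered

/-- STUB 2 (open boundary estimate): strip avoidance `P(Confᶜ) ≤ L h`. [folklore] -/
theorem stub_stripAvoidance :
    ∀ (D : Literature.Probability.RandomPlanarGeometry.DobrushinDomain) (a b : ℝ → Literature.Probability.LatticeModels.Site 2), Literature.Probability.RandomPlanarGeometry.SAW.IsEndpointApprox D a b → let P := fun (Ω : Set ℂ) (δ : ℝ) => Literature.Probability.RandomPlanarGeometry.SAW.law Ω δ (a δ) (b δ); ∀ (u : ℂ → ℂ) (U : Set ℂ), IsOpen U → closure D.carrier ⊆ U → DifferentiableOn ℂ u U → ContDiff ℝ 2 u → u (D.pt 0) = 0 → u (D.pt 1) = 0 → ∀ (g : ℝ → ℂ → ℂ) (hg : ∀ t, Continuous (g t)) (t₀ : ℝ), 0 < t₀ → (∀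 z, g 0 z = z) → (∀ t, ∃ K, LipschitzWith K (g t)) → (∀ t ∈ Set.Icc (0 : ℝ) t₀, ∀ z ∈ closure D.carrier, HasDerivAt (fun r => g r z) (u (g t z)) t) → (∀ t ∈ Set.Icc (0 : ℝ) t₀, g t '' D.carrier ⊆ D.carrier) → (∀ t ∈ Set.Icc (0 : ℝ) t₀, ∀ᶠ δ in nhdsWithin 0 (Set.Ioi 0), (Literature.Probability.LatticeModels.discreteDomainGraph (g t '' D.carrier) δ).Reachable (a δ) (b δ)) → ∃ L : ℝ, ∃ h₀ : ℝ, 0 < h₀ ∧ ∀ s ∈ Set.Icc (0 : ℝ) t₀, ∀ h ∈ Set.Ioc (0 : ℝ) h₀, s + h ≤ t₀ → ∀ᶠ δ in nhdsWithin 0 (Set.Ioi 0), ((P (g s '' D.carrier) δ) {γ | ∃ γ' : Literature.Probability.RandomPlanarGeometry.SAW.DomainSAW (g (s + h) '' D.carrier) δ (a δ) (b δ), γ'.walk.support = γ.walk.support}ᶜ).toReal ≤ L * h := by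
  sorry

/-- STUB 3 (THE HARD CORE, open): collar covariance = minus strip-touching covariance to `o(h)`. [folklore] -/
theorem stub_collarTouching :
    ∀ κ₁ κ₂ : ℝ → ℝ, (∀ (D : Literature.Probability.RandomPlanarGeometry.DobrushinDomain) (a b : ℝ → Literature.Probability.LatticeModels.Site 2), Literature.Probability.RandomPlanarGeometry.SAW.IsEndpointApprox D a b → let P := fun (Ω : Set ℂ) (δ : ℝ) => Literature.Probability.RandomPlanarGeometry.SAW.law Ω δ (a δ) (b δ); ∀ (v : ℂ → ℂ), ContDiff ℝ 2 v → tsupport v ⊆ D.carrier → ∀ (φ : ℝ → ℂ → ℂ) (hφ : ∀ t, Continuous (φ t)), (∀ z, φ 0 z = z) → (∀ t z, HasDerivAt (fun r => φ r z) (v (φ t z)) t) → ∀ f : BoundedContinuousFunction (Literature.Probability.RandomPlanarGeometry.CurveClass ℂ) ℝ, let strain : (ℂ → ℂ) → ℂ → ℂ := fun w z => fderiv ℝ w z 1 + Complex.I * fderiv ℝ w z Complex.I; let quad : ℝ → (ℂ → ℂ) → List (Literature.Probability.LatticeModels.Site 2) → ℝ := fun δ s xs => let l := xs.map (Literature.Probability.LatticeModels.meshPoint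 δ); κ₁ δ * (List.zipWith (fun p q : ℂ => (s ((p + q) / 2)).re * (((q - p).re) ^ 2 - ((q - p).im) ^ 2) / δ ^ 2) l l.tail).sum + κ₂ δ * (List.zipWith3 (fun p q r : ℂ => (s q).im * ((r - p).re * (r - p).im) / δ ^ 2) l l.tail l.tail.tail).sum; let fbar : Literature.Probability.RandomPlanarGeometry.CurveClass ℂ → ℝ := fun c => ∫ t in (0 : ℝ)..1, f (Literature.Probability.RandomPlanarGeometry.CurveClass.map ⟨φ t, hφ t⟩ c); Filter.Tendsto (fun δ : ℝ => (∫ γ, f (Literature.Probability.RandomPlanarGeometry.CurveClass.map ⟨φ 1, hφ 1⟩ γ.curve) ∂(P D.carrier δ)) - (∫ γ, f γ.curve ∂(P D.carrier δ)) - ((∫ γ, fbar γ.curve * quad δ (strain v) γ.walk.support ∂(P D.carrier δ)) - (∫ γ, fbar γ.curve ∂(P D.carrier δ)) * (∫ γ, quad δ (strain v) γ.walk.support ∂(P D.carrier δ)))) (nhdsWithin 0 (Set.Ioi 0)) (nhds 0)) → ∀ (D : Literature.Probability.RandomPlanarGeometry.DobrushinDomain) (a b : ℝ → Literature.Probability.LatticeModels.Site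 2), Literature.Probability.RandomPlanarGeometry.SAW.IsEndpointApprox D a b → let P := fun (Ω : Set ℂ) (δ : ℝ) => Literature.Probability.RandomPlanarGeometry.SAW.law Ω δ (a δ) (b δ); ∀ (u : ℂ → ℂ) (U : Set ℂ), IsOpen U → closure D.carrier ⊆ U → DifferentiableOn ℂ u U → ContDiff ℝ 2 u → u (D.pt 0) = 0 → u (D.pt 1) = 0 → ∀ (g : ℝ → ℂ → ℂ) (hg : ∀ t, Continuous (g t)) (t₀ : ℝ), 0 < t₀ → (∀ z, g 0 z = z) → (∀ t, ∃ K, LipschitzWith K (g t)) → (∀ t ∈ Set.Icc (0 : ℝ) t₀, ∀ z ∈ closure D.carrier, HasDerivAt (fun r => g r z) (u (g t z)) t) → (∀ t ∈ Set.Icc (0 : ℝ) t₀, g t '' D.carrier ⊆ D.carrier) → (∀ t ∈ Set.Icc (0 : ℝ) t₀, ∀ᶠ δ in nhdsWithin 0 (Set.Ioi 0), (Literature.Probability.LatticeModels.discreteDomainGraph (g t '' D.carrier) δ).Reachable (a δ) (b δ)) → ∀ (K : Set ℂ), IsCompact K → K ⊆ g t₀ '' D.carrier → ∀ (χ : ℂ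 → ℝ), ContDiff ℝ 2 χ → (∀ᶠ z in nhdsSet K, χ z = 1) → tsupport χ ⊆ g t₀ '' D.carrier → ∀ f : BoundedContinuousFunction (Literature.Probability.RandomPlanarGeometry.CurveClass ℂ) ℝ, (∀ ψ : ℂ ≃ₜ ℂ, (∀ z ∈ K, ψ z = z) → ∀ c, f (Literature.Probability.RandomPlanarGeometry.CurveClass.map (ψ : C(ℂ, ℂ)) c) = f c) → ∀ η : ℝ, 0 < η → ∃ h₀ : ℝ, 0 < h₀ ∧ ∀ s ∈ Set.Icc (0 : ℝ) t₀, ∀ h ∈ Set.Ioc (0 : ℝ) h₀, s + h ≤ t₀ → let strain : (ℂ → ℂ) → ℂ → ℂ := fun w z => fderiv ℝ w z 1 + Complex.I * fderiv ℝ w z Complex.I; let quad : ℝ → (ℂ → ℂ) → List (Literature.Probability.LatticeModels.Site 2) → ℝ := fun δ s xs => let l := xs.map (Literature.Probability.LatticeModels.meshPoint δ); κ₁ δ * (List.zipWith (fun p q : ℂ => (s ((p + q) / 2)).re * (((q - p).re) ^ 2 - ((q - p).im) ^ 2) / δ ^ 2) l l.tail).sum + κ₂ δ * (List.zipWith3 (fun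 p q r : ℂ => (s q).im * ((r - p).re * (r - p).im) / δ ^ 2) l l.tail l.tail.tail).sum; let v : ℂ → ℂ := fun z => (χ z : ℂ) * u z; ∀ᶠ δ in nhdsWithin 0 (Set.Ioi 0), |((∫ γ in {γ | ∃ γ' : Literature.Probability.RandomPlanarGeometry.SAW.DomainSAW (g (s + h) '' D.carrier) δ (a δ) (b δ), γ'.walk.support = γ.walk.support}ᶜ, f γ.curve ∂(P (g s '' D.carrier) δ)) - (∫ γ, f γ.curve ∂(P (g s '' D.carrier) δ)) * ((P (g s '' D.carrier) δ) {γ | ∃ γ' : Literature.Probability.RandomPlanarGeometry.SAW.DomainSAW (g (s + h) '' D.carrier) δ (a δ) (b δ), γ'.walk.support = γ.walk.support}ᶜ).toReal) + h * ((∫ γ, f γ.curve * quad δ (strain v) γ.walk.support ∂(P (g s '' D.carrier) δ)) - (∫ γ, f γ.curve ∂(P (g s '' D.carrier) δ)) * (∫ γ, quad δ (strain v) γ.walk.support ∂(P (g s '' D.carrier) δ)))| ≤ η * h := by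
  sorry

/-- STUB 4 (open, soft): equicontinuity of the collar response along the orbit. [folklore] -/
theorem stub_responseContinuity :
    ∀ κ₁ κ₂ : ℝ → ℝ, (∀ (D : Literature.Probability.RandomPlanarGeometry.DobrushinDomain) (a b : ℝ → Literature.Probability.LatticeModels.Site 2), Literature.Probability.RandomPlanarGeometry.SAW.IsEndpointApprox D a b → let P := fun (Ω : Set ℂ) (δ : ℝ) => Literature.Probability.RandomPlanarGeometry.SAW.law Ω δ (a δ) (b δ); ∀ (v : ℂ → ℂ), ContDiff ℝ 2 v → tsupport v ⊆ D.carrier → ∀ (φ : ℝ → ℂ → ℂ) (hφ : ∀ t, Continuous (φ t)), (∀ z, φ 0 z = z) → (∀ t z, HasDerivAt (fun r => φ r z) (v (φ t z)) t) → ∀ f : BoundedContinuousFunction (Literature.Probability.RandomPlanarGeometry.CurveClass ℂ) ℝ, let strain : (ℂ → ℂ) → ℂ → ℂ := fun w z => fderiv ℝ w z 1 + Complex.I * fderiv ℝ w z Complex.I; let quad : ℝ → (ℂ → ℂ) → List (Literature.Probability.LatticeModels.Site 2) → ℝ := fun δ s xs => let l := xs.map (Literature.Probability.LatticeModels.meshPoint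 δ); κ₁ δ * (List.zipWith (fun p q : ℂ => (s ((p + q) / 2)).re * (((q - p).re) ^ 2 - ((q - p).im) ^ 2) / δ ^ 2) l l.tail).sum + κ₂ δ * (List.zipWith3 (fun p q r : ℂ => (s q).im * ((r - p).re * (r - p).im) / δ ^ 2) l l.tail l.tail.tail).sum; let fbar : Literature.Probability.RandomPlanarGeometry.CurveClass ℂ → ℝ := fun c => ∫ t in (0 : ℝ)..1, f (Literature.Probability.RandomPlanarGeometry.CurveClass.map ⟨φ t, hφ t⟩ c); Filter.Tendsto (fun δ : ℝ => (∫ γ, f (Literature.Probability.RandomPlanarGeometry.CurveClass.map ⟨φ 1, hφ 1⟩ γ.curve) ∂(P D.carrier δ)) - (∫ γ, f γ.curve ∂(P D.carrier δ)) - ((∫ γ, fbar γ.curve * quad δ (strain v) γ.walk.support ∂(P D.carrier δ)) - (∫ γ, fbar γ.curve ∂(P D.carrier δ)) * (∫ γ, quad δ (strain v) γ.walk.support ∂(P D.carrier δ)))) (nhdsWithin 0 (Set.Ioi 0)) (nhds 0)) → ∀ (D : Literature.Probability.RandomPlanarGeometry.DobrushinDomain) (a b : ℝ → Literature.Probability.LatticeModels.Site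 2), Literature.Probability.RandomPlanarGeometry.SAW.IsEndpointApprox D a b → let P := fun (Ω : Set ℂ) (δ : ℝ) => Literature.Probability.RandomPlanarGeometry.SAW.law Ω δ (a δ) (b δ); ∀ (u : ℂ → ℂ) (U : Set ℂ), IsOpen U → closure D.carrier ⊆ U → DifferentiableOn ℂ u U → ContDiff ℝ 2 u → u (D.pt 0) = 0 → u (D.pt 1) = 0 → ∀ (g : ℝ → ℂ → ℂ) (hg : ∀ t, Continuous (g t)) (t₀ : ℝ), 0 < t₀ → (∀ z, g 0 z = z) → (∀ t, ∃ K, LipschitzWith K (g t)) → (∀ t ∈ Set.Icc (0 : ℝ) t₀, ∀ z ∈ closure D.carrier, HasDerivAt (fun r => g r z) (u (g t z)) t) → (∀ t ∈ Set.Icc (0 : ℝ) t₀, g t '' D.carrier ⊆ D.carrier) → (∀ t ∈ Set.Icc (0 : ℝ) t₀, ∀ᶠ δ in nhdsWithin 0 (Set.Ioi 0), (Literature.Probability.LatticeModels.discreteDomainGraph (g t '' D.carrier) δ).Reachable (a δ) (b δ)) → ∀ (K : Set ℂ), IsCompact K → K ⊆ g t₀ '' D.carrier → ∀ (χ : ℂ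 → ℝ), ContDiff ℝ 2 χ → (∀ᶠ z in nhdsSet K, χ z = 1) → tsupport χ ⊆ g t₀ '' D.carrier → ∀ f : BoundedContinuousFunction (Literature.Probability.RandomPlanarGeometry.CurveClass ℂ) ℝ, (∀ ψ : ℂ ≃ₜ ℂ, (∀ z ∈ K, ψ z = z) → ∀ c, f (Literature.Probability.RandomPlanarGeometry.CurveClass.map (ψ : C(ℂ, ℂ)) c) = f c) → ∀ η : ℝ, 0 < η → ∃ h₀ : ℝ, 0 < h₀ ∧ ∀ s ∈ Set.Icc (0 : ℝ) t₀, ∀ h ∈ Set.Ioc (0 : ℝ) h₀, s + h ≤ t₀ → let strain : (ℂ → ℂ) → ℂ → ℂ := fun w z => fderiv ℝ w z 1 + Complex.I * fderiv ℝ w z Complex.I; let quad : ℝ → (ℂ → ℂ) → List (Literature.Probability.LatticeModels.Site 2) → ℝ := fun δ s xs => let l := xs.map (Literature.Probability.LatticeModels.meshPoint δ); κ₁ δ * (List.zipWith (fun p q : ℂ => (s ((p + q) / 2)).re * (((q - p).re) ^ 2 - ((q - p).im) ^ 2) / δ ^ 2) l l.tail).sum + κ₂ δ * (List.zipWith3 (fun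 p q r : ℂ => (s q).im * ((r - p).re * (r - p).im) / δ ^ 2) l l.tail l.tail.tail).sum; let v : ℂ → ℂ := fun z => (χ z : ℂ) * u z; let C : ℝ → ℝ → ℝ := fun r δ => ((∫ γ, f γ.curve * quad δ (strain v) γ.walk.support ∂(P (g r '' D.carrier) δ)) - (∫ γ, f γ.curve ∂(P (g r '' D.carrier) δ)) * (∫ γ, quad δ (strain v) γ.walk.support ∂(P (g r '' D.carrier) δ))); ∀ᶠ δ in nhdsWithin 0 (Set.Ioi 0), |h * C s δ - ((∫ r in (0 : ℝ)..(s + h), C r δ) - (∫ r in (0 : ℝ)..s, C r δ))| ≤ η * h := by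
  sorry

open Filter Set

/-- **One flow step.** Abstract form of the four inputs on a time step `[s, s+h]`:
exact restriction `F₁ (1 - q) = F₀ - A` (`q` = probability that the walk of the big domain
leaves the small one, `A` = the integral of the observable over that event), the covariance
bound `|A - F₀ q| ≤ 2 B q` (`B` = sup-norm of the observable), strip avoidance `q ≤ L h` with
`L h ≤ 1/2`, the touching identity `|(A - F₀ q) + h C| ≤ η h` and response continuity
`|h C - ΔJ| ≤ η h`; if moreover `4 B L² h ≤ η` then `|F₁ - F₀ - ΔJ| ≤ 3 η h`. [folklore] -/
theorem abs_step_le {F₀ F₁ A q C ΔJ B L η h : ℝ} (hB : 0 ≤ B) (hh : 0 ≤ h)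
    (hq : 0 ≤ q) (hqL : q ≤ L * h) (hLh : L * h ≤ 1 / 2)
    (hR : F₁ * (1 - q) = F₀ - A) (hΘ : |A - F₀ * q| ≤ 2 * B * q)
    (hP : |(A - F₀ * q) + h * C| ≤ η * h) (hC : |h * C - ΔJ| ≤ η * h)
    (hsmall : 4 * B * L ^ 2 * h ≤ η) :
    |F₁ - F₀ - ΔJ| ≤ 3 * η * h := by
  -- the restriction identity in covariance form
  have e1 : F₁ - F₀ + (A - F₀ * q) = (F₁ - F₀) * q := by linear_combination hR
  have e2 : (F₁ - F₀) * (1 - q) = -(A - F₀ * q) := by linear_combination hR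
  have hq1 : 1 / 2 ≤ 1 - q := by linarith
  -- |F₁ - F₀| ≤ 4 B q
  have h3 : |F₁ - F₀| * (1 - q) ≤ 2 * B * q := by
    have : |(F₁ - F₀) * (1 - q)| = |F₁ - F₀| * (1 - q) := by
      rw [abs_mul, abs_of_nonneg (by linarith : (0:ℝ) ≤ 1 - q)]
    rw [← this, e2, abs_neg]
    exact hΘ
  have h4 : |F₁ - F₀| ≤ 4 * B * q := by nlinarith [abs_nonneg (F₁ - F₀)]
  -- first bracket: |F₁ - F₀ + Θ| = |F₁ - F₀| q ≤ 4 B q² ≤ 4 B L² h² ≤ η h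
  have hLh0 : 0 ≤ L * h := hq.trans hqL
  have h5 : |F₁ - F₀ + (A - F₀ * q)| ≤ η * h := by
    rw [e1, abs_mul, abs_of_nonneg hq]
    calc |F₁ - F₀| * q ≤ 4 * B * q * q := by nlinarith [abs_nonneg (F₁ - F₀)]
      _ ≤ 4 * B * (L * h) * (L * h) := by
          have hqq : q * q ≤ (L * h) * (L * h) := mul_le_mul hqL hqL hq hLh0
          have h4B : (0:ℝ) ≤ 4 * B := by positivity
          calc 4 * B * q * q = 4 * B * (q * q) := by ring
            _ ≤ 4 * B * ((L * h) * (L * h)) := mul_le_mul_of_nonneg_left hqq h4B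
            _ = 4 * B * (L * h) * (L * h) := by ring
      _ = 4 * B * L ^ 2 * h * h := by ring
      _ ≤ η * h := by nlinarith
  -- triangle inequality
  have key : F₁ - F₀ - ΔJ =
      (F₁ - F₀ + (A - F₀ * q)) + (-((A - F₀ * q) + h * C)) + (h * C - ΔJ) := by ring
  rw [key]
  calc |(F₁ - F₀ + (A - F₀ * q)) + (-((A - F₀ * q) + h * C)) + (h * C - ΔJ)|
      ≤ |F₁ - F₀ + (A - F₀ * q)| + |(-((A - F₀ * q) + h * C))| + |h * C - ΔJ| :=
        abs_add_three _ _ _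
    _ ≤ η * h + η * h + η * h := by rw [abs_neg]; exact add_le_add (add_le_add h5 hP) hC
    _ = 3 * η * h := by ring

/-- **Telescoping.** If for every `η > 0` the one-step error
`|F(s+h) - F(s) - (J(s+h) - J(s))|` is at most `η h`, eventually along `l`, for all steps
`[s, s+h] ⊆ [0, t₀]` of length `h ≤ h₀(η)`, then `F(t) - F(0) - (J(t) - J(0)) → 0` along `l`
for every `t ∈ (0, t₀]` (chop `[0, t]` into `n` equal steps and let `η → 0`). [folklore] -/
theorem tendsto_of_uniform_steps {l : Filter ℝ} {F J : ℝ → ℝ → ℝ} {t₀ t : ℝ}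
    (hstep : ∀ η : ℝ, 0 < η → ∃ h₀ : ℝ, 0 < h₀ ∧ ∀ s ∈ Set.Icc (0:ℝ) t₀, ∀ h ∈ Set.Ioc (0:ℝ) h₀,
      s + h ≤ t₀ → ∀ᶠ δ in l, |F (s + h) δ - F s δ - (J (s + h) δ - J s δ)| ≤ η * h)
    (ht : t ∈ Set.Ioc (0:ℝ) t₀) :
    Tendsto (fun δ => F t δ - F 0 δ - (J t δ - J 0 δ)) l (nhds 0) := by
  rw [Metric.tendsto_nhds]
  intro ε hε
  obtain ⟨htpos, htle⟩ := ht
  -- choose η with η t = ε / 2 and the step bound h₀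
  obtain ⟨h₀, hh₀, H⟩ := hstep (ε / (2 * t)) (by positivity)
  -- number of steps
  obtain ⟨n, hn⟩ : ∃ n : ℕ, t / h₀ ≤ n := exists_nat_ge (t / h₀)
  have hnpos : (0:ℝ) < n := lt_of_lt_of_le (by positivity) hn
  have hn0 : (n:ℝ) ≠ 0 := hnpos.ne'
  set h : ℝ := t / n with hh_def
  have hhpos : 0 < h := by positivity
  have hhle : h ≤ h₀ := by
    rw [hh_def, div_le_iff₀ hnpos]
    calc t = (t / h₀) * h₀ := by field_simp
      _ ≤ n * h₀ := by gcongr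
      _ = h₀ * n := by ring
  have hnh : (n:ℝ) * h = t := by rw [hh_def]; field_simp
  -- the one-step bounds at the grid points, eventually and simultaneously
  have hgrid : ∀ i ∈ Finset.range n, ∀ᶠ δ in l,
      |F ((i:ℝ) * h + h) δ - F ((i:ℝ) * h) δ - (J ((i:ℝ) * h + h) δ - J ((i:ℝ) * h) δ)|
        ≤ ε / (2 * t) * h := by
    intro i hi
    have hi' : (i:ℝ) + 1 ≤ n := by
      have := Finset.mem_range.1 hi
      exact_mod_cast this
    have hi0 : (0:ℝ) ≤ i := by positivity
    refine H ((i:ℝ) * h) ⟨by positivity, ?_⟩ h ⟨hhpos, hhle⟩ ?_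
    · have hin : (i:ℝ) ≤ n := by linarith
      calc (i:ℝ) * h ≤ n * h := mul_le_mul_of_nonneg_right hin hhpos.le
        _ = t := hnh
        _ ≤ t₀ := htle
    · calc (i:ℝ) * h + h = ((i:ℝ) + 1) * h := by ring
        _ ≤ n * h := by gcongr
        _ = t := hnh
        _ ≤ t₀ := htle
  have hall := (Filter.eventually_all_finset (Finset.range n)).2 hgrid
  refine hall.mono fun δ hδ => ?_
  -- telescoping sum
  have tele : F t δ - F 0 δ - (J t δ - J 0 δ) =
      ∑ i ∈ Finset.range n, ((F (((i+1:ℕ):ℝ) * h) δ - J (((i+1:ℕ):ℝ) * h) δ) -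
        (F ((i:ℝ) * h) δ - J ((i:ℝ) * h) δ)) := by
    rw [Finset.sum_range_sub (fun i : ℕ => F ((i:ℝ) * h) δ - J ((i:ℝ) * h) δ) n]
    simp only [Nat.cast_zero, zero_mul, hnh]
    ring
  rw [Real.dist_eq, sub_zero, tele]
  calc |∑ i ∈ Finset.range n, ((F (((i+1:ℕ):ℝ) * h) δ - J (((i+1:ℕ):ℝ) * h) δ) -
          (F ((i:ℝ) * h) δ - J ((i:ℝ) * h) δ))|
      ≤ ∑ i ∈ Finset.range n, |(F (((i+1:ℕ):ℝ) * h) δ - J (((i+1:ℕ):ℝ) * h) δ) -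
          (F ((i:ℝ) * h) δ - J ((i:ℝ) * h) δ)| := Finset.abs_sum_le_sum_abs _ _
    _ ≤ ∑ i ∈ Finset.range n, ε / (2 * t) * h := by
        refine Finset.sum_le_sum fun i hi => ?_
        have := hδ i hi
        have e : ((i+1:ℕ):ℝ) * h = (i:ℝ) * h + h := by push_cast; ring
        rw [e]
        calc |F ((i:ℝ) * h + h) δ - J ((i:ℝ) * h + h) δ - (F ((i:ℝ) * h) δ - J ((i:ℝ) * h) δ)|
            = |F ((i:ℝ) * h + h) δ - F ((i:ℝ) * h) δ -
                (J ((i:ℝ) * h + h) δ - J ((i:ℝ) * h) δ)| := by ring_nf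
          _ ≤ ε / (2 * t) * h := this
    _ = n * (ε / (2 * t) * h) := by rw [Finset.sum_const, Finset.card_range, nsmul_eq_mul]
    _ = ε / 2 := by rw [← hnh]; field_simp
    _ < ε := by linarith

end Summit.CriticalPhenomena.SAWScalingLimit.Cruxes.BoundaryWard.CollarStepTelescoping

namespace Summit.CriticalPhenomena.SAWScalingLimit.Cruxes.BoundaryWard.CollarStepTelescoping

open MeasureTheory Filter Set
open scoped Topology ENNReal
open Literature.Probability.LatticeModels Literature.Probability.RandomPlanarGeometry
open Literature.Probability.RandomPlanarGeometry.SAW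

/-! ## Measure-theoretic facts about the observable `γ ↦ f(γ.curve)` -/

section Obs

variable {Ω : Set ℂ} {δ : ℝ} {a' b' : Site 2}

/-- A bounded continuous observable of the curve is integrable against any finite measure on the
(discrete) space of SAWs. [folklore] -/
theorem integrable_obs (f : BoundedContinuousFunction (CurveClass ℂ) ℝ)
    (μ : Measure (DomainSAW Ω δ a' b')) [IsFiniteMeasure μ] :
    Integrable (fun γ => f γ.curve) μ :=
  Integrable.of_bound (DomainSAW.measurable_of_top _).aestronglyMeasurable ‖f‖
    (Eventually.of_forall fun γ => f.norm_coe_le_norm γ.curve)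

/-- **Covariance with an indicator is at most `2‖f‖` times the probability**: for a probability
measure `μ` and any event `S`, `|∫_S f − (∫ f) · μ(S)| ≤ 2 ‖f‖ μ(S)`. [folklore] -/
theorem abs_setIntegral_sub_mul_le (f : BoundedContinuousFunction (CurveClass ℂ) ℝ)
    (μ : Measure (DomainSAW Ω δ a' b')) [IsProbabilityMeasure μ] (S : Set (DomainSAW Ω δ a' b')) :
    |(∫ γ in S, f γ.curve ∂μ) - (∫ γ, f γ.curve ∂μ) * (μ S).toReal| ≤ 2 * ‖f‖ * (μ S).toReal := by
  have hint : Integrable (fun γ => f γ.curve) μ := integrable_obs f μ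
  have hF : |∫ γ, f γ.curve ∂μ| ≤ ‖f‖ := by
    have h := norm_integral_le_of_norm_le_const (μ := μ) (f := fun γ => f γ.curve) (C := ‖f‖)
      (Eventually.of_forall fun γ => f.norm_coe_le_norm γ.curve)
    simpa [Real.norm_eq_abs] using h
  have e : (∫ γ in S, f γ.curve ∂μ) - (∫ γ, f γ.curve ∂μ) * (μ S).toReal =
      ∫ γ in S, (f γ.curve - ∫ γ', f γ'.curve ∂μ) ∂μ := by
    rw [integral_sub hint.integrableOn (integrableOn_const (hs := measure_ne_top μ S)),
      setIntegral_const, measureReal_def, smul_eq_mul, mul_comm]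
  rw [e]
  have hb : ∀ γ ∈ S, ‖f γ.curve - ∫ γ', f γ'.curve ∂μ‖ ≤ 2 * ‖f‖ := by
    intro γ _
    calc ‖f γ.curve - ∫ γ', f γ'.curve ∂μ‖ ≤ ‖f γ.curve‖ + ‖∫ γ', f γ'.curve ∂μ‖ := norm_sub_le _ _
      _ ≤ ‖f‖ + ‖f‖ := add_le_add (f.norm_coe_le_norm γ.curve) (by simpa [Real.norm_eq_abs] using hF)
      _ = 2 * ‖f‖ := by ring
  have h := norm_setIntegral_le_of_norm_le_const (measure_lt_top μ S) hb
  rw [measureReal_def, Real.norm_eq_abs] at h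
  exact h

/-- For a probability measure, `μ(S) = 1 − μ(Sᶜ)` in `ℝ`. [folklore] -/
theorem toReal_eq_one_sub_toReal_compl (μ : Measure (DomainSAW Ω δ a' b')) [IsProbabilityMeasure μ]
    (S : Set (DomainSAW Ω δ a' b')) : (μ S).toReal = 1 - (μ Sᶜ).toReal := by
  have hS : MeasurableSet S := MeasurableSpace.measurableSet_top
  have h := prob_compl_eq_one_sub hS (μ := μ)
  rw [h, ENNReal.toReal_sub_of_le prob_le_one ENNReal.one_ne_top, ENNReal.toReal_one]
  ring

/-- `∫_S f = ∫ f − ∫_{Sᶜ} f`. [folklore] -/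
theorem setIntegral_eq_integral_sub_compl (f : BoundedContinuousFunction (CurveClass ℂ) ℝ)
    (μ : Measure (DomainSAW Ω δ a' b')) [IsFiniteMeasure μ] (S : Set (DomainSAW Ω δ a' b')) :
    ∫ γ in S, f γ.curve ∂μ = (∫ γ, f γ.curve ∂μ) - ∫ γ in Sᶜ, f γ.curve ∂μ := by
  have h := integral_add_compl (MeasurableSpace.measurableSet_top (s := S)) (integrable_obs f μ)
  linarith

end Obs

/-! ## The glue -/

/-- **The typed decomposition of `BoundaryWard`.** Exact lattice restriction along the flow,
strip avoidance, the collar/touching identity and the equicontinuity of the collar response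
imply the boundary Ward identity `BoundaryWard` (stmt-CriticalPhenomena-6556) of route
`SAWQuadrupoleWard`: on each flow step `[s, s+h]` the four inputs give
`|E_{(D_{s+h})_δ}[f] − E_{(D_s)_δ}[f] − ∫ₛ^{s+h} C(r, δ) dr| ≤ 3ηh` eventually in `δ`
(`abs_step_le`), and chopping `[0, t]` into `n` steps of length `≤ h₀(η)` gives
`|E_{(D_t)_δ}[f] − E_{D_δ}[f] − ∫₀ᵗ C| ≤ 3ηt` eventually, for every `η > 0`
(`tendsto_of_uniform_steps`). [folklore] -/
theorem boundaryWard_of_subs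
    (hR : ∀ (D : Literature.Probability.RandomPlanarGeometry.DobrushinDomain) (a b : ℝ → Literature.Probability.LatticeModels.Site 2), Literature.Probability.RandomPlanarGeometry.SAW.IsEndpointApprox D a b → let P := fun (Ω : Set ℂ) (δ : ℝ) => Literature.Probability.RandomPlanarGeometry.SAW.law Ω δ (a δ) (b δ); ∀ (u : ℂ → ℂ) (U : Set ℂ), IsOpen U → closure D.carrier ⊆ U → DifferentiableOn ℂ u U → ContDiff ℝ 2 u → u (D.pt 0) = 0 → u (D.pt 1) = 0 → ∀ (g : ℝ → ℂ → ℂ) (hg : ∀ t, Continuous (g t)) (t₀ : ℝ), 0 < t₀ → (∀ z, g 0 z = z) → (∀ t, ∃ K, LipschitzWith K (g t)) → (∀ t ∈ Set.Icc (0 : ℝ) t₀, ∀ z ∈ closure D.carrier, HasDerivAt (fun r => g r z) (u (g t z)) t) → (∀ t ∈ Set.Icc (0 : ℝ) t₀, g t '' D.carrier ⊆ D.carrier) → (∀ t ∈ Set.Icc (0 : ℝ) t₀, ∀ᶠ δ in nhdsWithin 0 (Set.Ioi 0), (Literature.Probability.LatticeModels.discreteDomainGraph (g t '' D.carrier) δ).Reachable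 (a δ) (b δ)) → ∀ f : BoundedContinuousFunction (Literature.Probability.RandomPlanarGeometry.CurveClass ℂ) ℝ, ∀ s ∈ Set.Icc (0 : ℝ) t₀, ∀ h : ℝ, 0 < h → s + h ≤ t₀ → ∀ᶠ δ in nhdsWithin 0 (Set.Ioi 0), MeasureTheory.IsProbabilityMeasure (P (g s '' D.carrier) δ) ∧ (∫ γ, f γ.curve ∂(P (g (s + h) '' D.carrier) δ)) * ((P (g s '' D.carrier) δ) {γ | ∃ γ' : Literature.Probability.RandomPlanarGeometry.SAW.DomainSAW (g (s + h) '' D.carrier) δ (a δ) (b δ), γ'.walk.support = γ.walk.support}).toReal = ∫ γ in {γ | ∃ γ' : Literature.Probability.RandomPlanarGeometry.SAW.DomainSAW (g (s + h) '' D.carrier) δ (a δ) (b δ), γ'.walk.support = γ.walk.support}, f γ.curve ∂(P (g s '' D.carrier) δ))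
    (hV : ∀ (D : Literature.Probability.RandomPlanarGeometry.DobrushinDomain) (a b : ℝ → Literature.Probability.LatticeModels.Site 2), Literature.Probability.RandomPlanarGeometry.SAW.IsEndpointApprox D a b → let P := fun (Ω : Set ℂ) (δ : ℝ) => Literature.Probability.RandomPlanarGeometry.SAW.law Ω δ (a δ) (b δ); ∀ (u : ℂ → ℂ) (U : Set ℂ), IsOpen U → closure D.carrier ⊆ U → DifferentiableOn ℂ u U → ContDiff ℝ 2 u → u (D.pt 0) = 0 → u (D.pt 1) = 0 → ∀ (g : ℝ → ℂ → ℂ) (hg : ∀ t, Continuous (g t)) (t₀ : ℝ), 0 < t₀ → (∀ z, g 0 z = z) → (∀ t, ∃ K, LipschitzWith K (g t)) → (∀ t ∈ Set.Icc (0 : ℝ) t₀, ∀ z ∈ closure D.carrier, HasDerivAt (fun r => g r z) (u (g t z)) t) → (∀ t ∈ Set.Icc (0 : ℝ) t₀, g t '' D.carrier ⊆ D.carrier) → (∀ t ∈ Set.Icc (0 : ℝ) t₀, ∀ᶠ δ in nhdsWithin 0 (Set.Ioi 0), (Literature.Probability.LatticeModels.discreteDomainGraph (g t '' D.carrier) δ).Reachable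 (a δ) (b δ)) → ∃ L : ℝ, ∃ h₀ : ℝ, 0 < h₀ ∧ ∀ s ∈ Set.Icc (0 : ℝ) t₀, ∀ h ∈ Set.Ioc (0 : ℝ) h₀, s + h ≤ t₀ → ∀ᶠ δ in nhdsWithin 0 (Set.Ioi 0), ((P (g s '' D.carrier) δ) {γ | ∃ γ' : Literature.Probability.RandomPlanarGeometry.SAW.DomainSAW (g (s + h) '' D.carrier) δ (a δ) (b δ), γ'.walk.support = γ.walk.support}ᶜ).toReal ≤ L * h)
    (hP : ∀ κ₁ κ₂ : ℝ → ℝ, (∀ (D : Literature.Probability.RandomPlanarGeometry.DobrushinDomain) (a b : ℝ → Literature.Probability.LatticeModels.Site 2), Literature.Probability.RandomPlanarGeometry.SAW.IsEndpointApprox D a b → let P := fun (Ω : Set ℂ) (δ : ℝ) => Literature.Probability.RandomPlanarGeometry.SAW.law Ω δ (a δ) (b δ); ∀ (v : ℂ → ℂ), ContDiff ℝ 2 v → tsupport v ⊆ D.carrier → ∀ (φ : ℝ → ℂ → ℂ) (hφ : ∀ t, Continuous (φ t)), (∀ z, φ 0 z = z) → (∀ t z, HasDerivAt (fun r => φ r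 z) (v (φ t z)) t) → ∀ f : BoundedContinuousFunction (Literature.Probability.RandomPlanarGeometry.CurveClass ℂ) ℝ, let strain : (ℂ → ℂ) → ℂ → ℂ := fun w z => fderiv ℝ w z 1 + Complex.I * fderiv ℝ w z Complex.I; let quad : ℝ → (ℂ → ℂ) → List (Literature.Probability.LatticeModels.Site 2) → ℝ := fun δ s xs => let l := xs.map (Literature.Probability.LatticeModels.meshPoint δ); κ₁ δ * (List.zipWith (fun p q : ℂ => (s ((p + q) / 2)).re * (((q - p).re) ^ 2 - ((q - p).im) ^ 2) / δ ^ 2) l l.tail).sum + κ₂ δ * (List.zipWith3 (fun p q r : ℂ => (s q).im * ((r - p).re * (r - p).im) / δ ^ 2) l l.tail l.tail.tail).sum; let fbar : Literature.Probability.RandomPlanarGeometry.CurveClass ℂ → ℝ := fun c => ∫ t in (0 : ℝ)..1, f (Literature.Probability.RandomPlanarGeometry.CurveClass.map ⟨φ t, hφ t⟩ c); Filter.Tendsto (fun δ : ℝ => (∫ γ, f (Literature.Probability.RandomPlanarGeometry.CurveClass.map ⟨φ 1, hφ 1⟩ γ.curve) ∂(P D.carrier δ)) - (∫ γ, f γ.curve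 ∂(P D.carrier δ)) - ((∫ γ, fbar γ.curve * quad δ (strain v) γ.walk.support ∂(P D.carrier δ)) - (∫ γ, fbar γ.curve ∂(P D.carrier δ)) * (∫ γ, quad δ (strain v) γ.walk.support ∂(P D.carrier δ)))) (nhdsWithin 0 (Set.Ioi 0)) (nhds 0)) → ∀ (D : Literature.Probability.RandomPlanarGeometry.DobrushinDomain) (a b : ℝ → Literature.Probability.LatticeModels.Site 2), Literature.Probability.RandomPlanarGeometry.SAW.IsEndpointApprox D a b → let P := fun (Ω : Set ℂ) (δ : ℝ) => Literature.Probability.RandomPlanarGeometry.SAW.law Ω δ (a δ) (b δ); ∀ (u : ℂ → ℂ) (U : Set ℂ), IsOpen U → closure D.carrier ⊆ U → DifferentiableOn ℂ u U → ContDiff ℝ 2 u → u (D.pt 0) = 0 → u (D.pt 1) = 0 → ∀ (g : ℝ → ℂ → ℂ) (hg : ∀ t, Continuous (g t)) (t₀ : ℝ), 0 < t₀ → (∀ z, g 0 z = z) → (∀ t, ∃ K, LipschitzWith K (g t)) → (∀ t ∈ Set.Icc (0 : ℝ) t₀, ∀ z ∈ closure D.carrier, HasDerivAt (fun r => g r z)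 (u (g t z)) t) → (∀ t ∈ Set.Icc (0 : ℝ) t₀, g t '' D.carrier ⊆ D.carrier) → (∀ t ∈ Set.Icc (0 : ℝ) t₀, ∀ᶠ δ in nhdsWithin 0 (Set.Ioi 0), (Literature.Probability.LatticeModels.discreteDomainGraph (g t '' D.carrier) δ).Reachable (a δ) (b δ)) → ∀ (K : Set ℂ), IsCompact K → K ⊆ g t₀ '' D.carrier → ∀ (χ : ℂ → ℝ), ContDiff ℝ 2 χ → (∀ᶠ z in nhdsSet K, χ z = 1) → tsupport χ ⊆ g t₀ '' D.carrier → ∀ f : BoundedContinuousFunction (Literature.Probability.RandomPlanarGeometry.CurveClass ℂ) ℝ, (∀ ψ : ℂ ≃ₜ ℂ, (∀ z ∈ K, ψ z = z) → ∀ c, f (Literature.Probability.RandomPlanarGeometry.CurveClass.map (ψ : C(ℂ, ℂ)) c) = f c) → ∀ η : ℝ, 0 < η → ∃ h₀ : ℝ, 0 < h₀ ∧ ∀ s ∈ Set.Icc (0 : ℝ) t₀, ∀ h ∈ Set.Ioc (0 : ℝ) h₀, s + h ≤ t₀ → let strain : (ℂ → ℂ) → ℂ → ℂ := fun w z => fderiv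 ℝ w z 1 + Complex.I * fderiv ℝ w z Complex.I; let quad : ℝ → (ℂ → ℂ) → List (Literature.Probability.LatticeModels.Site 2) → ℝ := fun δ s xs => let l := xs.map (Literature.Probability.LatticeModels.meshPoint δ); κ₁ δ * (List.zipWith (fun p q : ℂ => (s ((p + q) / 2)).re * (((q - p).re) ^ 2 - ((q - p).im) ^ 2) / δ ^ 2) l l.tail).sum + κ₂ δ * (List.zipWith3 (fun p q r : ℂ => (s q).im * ((r - p).re * (r - p).im) / δ ^ 2) l l.tail l.tail.tail).sum; let v : ℂ → ℂ := fun z => (χ z : ℂ) * u z; ∀ᶠ δ in nhdsWithin 0 (Set.Ioi 0), |((∫ γ in {γ | ∃ γ' : Literature.Probability.RandomPlanarGeometry.SAW.DomainSAW (g (s + h) '' D.carrier) δ (a δ) (b δ), γ'.walk.support = γ.walk.support}ᶜ, f γ.curve ∂(P (g s '' D.carrier) δ)) - (∫ γ, f γ.curve ∂(P (g s '' D.carrier) δ)) * ((P (g s '' D.carrier) δ) {γ | ∃ γ' : Literature.Probability.RandomPlanarGeometry.SAW.DomainSAW (g (s + h) '' D.carrier) δ (a δ) (b δ), γ'.walk.support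 = γ.walk.support}ᶜ).toReal) + h * ((∫ γ, f γ.curve * quad δ (strain v) γ.walk.support ∂(P (g s '' D.carrier) δ)) - (∫ γ, f γ.curve ∂(P (g s '' D.carrier) δ)) * (∫ γ, quad δ (strain v) γ.walk.support ∂(P (g s '' D.carrier) δ)))| ≤ η * h)
    (hC : ∀ κ₁ κ₂ : ℝ → ℝ, (∀ (D : Literature.Probability.RandomPlanarGeometry.DobrushinDomain) (a b : ℝ → Literature.Probability.LatticeModels.Site 2), Literature.Probability.RandomPlanarGeometry.SAW.IsEndpointApprox D a b → let P := fun (Ω : Set ℂ) (δ : ℝ) => Literature.Probability.RandomPlanarGeometry.SAW.law Ω δ (a δ) (b δ); ∀ (v : ℂ → ℂ), ContDiff ℝ 2 v → tsupport v ⊆ D.carrier → ∀ (φ : ℝ → ℂ → ℂ) (hφ : ∀ t, Continuous (φ t)), (∀ z, φ 0 z = z) → (∀ t z, HasDerivAt (fun r => φ r z) (v (φ t z)) t) → ∀ f : BoundedContinuousFunction (Literature.Probability.RandomPlanarGeometry.CurveClass ℂ) ℝ, let strain : (ℂ → ℂ) → ℂ → ℂ := fun w z => fderiv ℝ w z 1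 + Complex.I * fderiv ℝ w z Complex.I; let quad : ℝ → (ℂ → ℂ) → List (Literature.Probability.LatticeModels.Site 2) → ℝ := fun δ s xs => let l := xs.map (Literature.Probability.LatticeModels.meshPoint δ); κ₁ δ * (List.zipWith (fun p q : ℂ => (s ((p + q) / 2)).re * (((q - p).re) ^ 2 - ((q - p).im) ^ 2) / δ ^ 2) l l.tail).sum + κ₂ δ * (List.zipWith3 (fun p q r : ℂ => (s q).im * ((r - p).re * (r - p).im) / δ ^ 2) l l.tail l.tail.tail).sum; let fbar : Literature.Probability.RandomPlanarGeometry.CurveClass ℂ → ℝ := fun c => ∫ t in (0 : ℝ)..1, f (Literature.Probability.RandomPlanarGeometry.CurveClass.map ⟨φ t, hφ t⟩ c); Filter.Tendsto (fun δ : ℝ => (∫ γ, f (Literature.Probability.RandomPlanarGeometry.CurveClass.map ⟨φ 1, hφ 1⟩ γ.curve) ∂(P D.carrier δ)) - (∫ γ, f γ.curve ∂(P D.carrier δ)) - ((∫ γ, fbar γ.curve * quad δ (strain v) γ.walk.support ∂(P D.carrier δ)) - (∫ γ, fbar γ.curve ∂(P D.carrier δ)) * (∫ γ, quad δ (strain v)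 γ.walk.support ∂(P D.carrier δ)))) (nhdsWithin 0 (Set.Ioi 0)) (nhds 0)) → ∀ (D : Literature.Probability.RandomPlanarGeometry.DobrushinDomain) (a b : ℝ → Literature.Probability.LatticeModels.Site 2), Literature.Probability.RandomPlanarGeometry.SAW.IsEndpointApprox D a b → let P := fun (Ω : Set ℂ) (δ : ℝ) => Literature.Probability.RandomPlanarGeometry.SAW.law Ω δ (a δ) (b δ); ∀ (u : ℂ → ℂ) (U : Set ℂ), IsOpen U → closure D.carrier ⊆ U → DifferentiableOn ℂ u U → ContDiff ℝ 2 u → u (D.pt 0) = 0 → u (D.pt 1) = 0 → ∀ (g : ℝ → ℂ → ℂ) (hg : ∀ t, Continuous (g t)) (t₀ : ℝ), 0 < t₀ → (∀ z, g 0 z = z) → (∀ t, ∃ K, LipschitzWith K (g t)) → (∀ t ∈ Set.Icc (0 : ℝ) t₀, ∀ z ∈ closure D.carrier, HasDerivAt (fun r => g r z) (u (g t z)) t) → (∀ t ∈ Set.Icc (0 : ℝ) t₀, g t '' D.carrier ⊆ D.carrier) → (∀ t ∈ Set.Icc (0 : ℝ) t₀, ∀ᶠ δ in nhdsWithin 0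 (Set.Ioi 0), (Literature.Probability.LatticeModels.discreteDomainGraph (g t '' D.carrier) δ).Reachable (a δ) (b δ)) → ∀ (K : Set ℂ), IsCompact K → K ⊆ g t₀ '' D.carrier → ∀ (χ : ℂ → ℝ), ContDiff ℝ 2 χ → (∀ᶠ z in nhdsSet K, χ z = 1) → tsupport χ ⊆ g t₀ '' D.carrier → ∀ f : BoundedContinuousFunction (Literature.Probability.RandomPlanarGeometry.CurveClass ℂ) ℝ, (∀ ψ : ℂ ≃ₜ ℂ, (∀ z ∈ K, ψ z = z) → ∀ c, f (Literature.Probability.RandomPlanarGeometry.CurveClass.map (ψ : C(ℂ, ℂ)) c) = f c) → ∀ η : ℝ, 0 < η → ∃ h₀ : ℝ, 0 < h₀ ∧ ∀ s ∈ Set.Icc (0 : ℝ) t₀, ∀ h ∈ Set.Ioc (0 : ℝ) h₀, s + h ≤ t₀ → let strain : (ℂ → ℂ) → ℂ → ℂ := fun w z => fderiv ℝ w z 1 + Complex.I * fderiv ℝ w z Complex.I; let quad : ℝ → (ℂ → ℂ) → List (Literature.Probability.LatticeModels.Site 2) → ℝ := fun δ s xs => let l := xs.map (Literature.Probability.LatticeModels.meshPoint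 δ); κ₁ δ * (List.zipWith (fun p q : ℂ => (s ((p + q) / 2)).re * (((q - p).re) ^ 2 - ((q - p).im) ^ 2) / δ ^ 2) l l.tail).sum + κ₂ δ * (List.zipWith3 (fun p q r : ℂ => (s q).im * ((r - p).re * (r - p).im) / δ ^ 2) l l.tail l.tail.tail).sum; let v : ℂ → ℂ := fun z => (χ z : ℂ) * u z; let C : ℝ → ℝ → ℝ := fun r δ => ((∫ γ, f γ.curve * quad δ (strain v) γ.walk.support ∂(P (g r '' D.carrier) δ)) - (∫ γ, f γ.curve ∂(P (g r '' D.carrier) δ)) * (∫ γ, quad δ (strain v) γ.walk.support ∂(P (g r '' D.carrier) δ))); ∀ᶠ δ in nhdsWithin 0 (Set.Ioi 0), |h * C s δ - ((∫ r in (0 : ℝ)..(s + h), C r δ) - (∫ r in (0 : ℝ)..s, C r δ))| ≤ η * h) :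
    ∀ κ₁ κ₂ : ℝ → ℝ, (∀ (D : Literature.Probability.RandomPlanarGeometry.DobrushinDomain) (a b : ℝ → Literature.Probability.LatticeModels.Site 2), Literature.Probability.RandomPlanarGeometry.SAW.IsEndpointApprox D a b → let P := fun (Ω : Set ℂ) (δ : ℝ) => Literature.Probability.RandomPlanarGeometry.SAW.law Ω δ (a δ) (b δ); ∀ (v : ℂ → ℂ), ContDiff ℝ 2 v → tsupport v ⊆ D.carrier → ∀ (φ : ℝ → ℂ → ℂ) (hφ : ∀ t, Continuous (φ t)), (∀ z, φ 0 z = z) → (∀ t z, HasDerivAt (fun r => φ r z) (v (φ t z)) t) → ∀ f : BoundedContinuousFunction (Literature.Probability.RandomPlanarGeometry.CurveClass ℂ) ℝ, let strain : (ℂ → ℂ) → ℂ → ℂ := fun w z => fderiv ℝ w z 1 + Complex.I * fderiv ℝ w z Complex.I; let quad : ℝ → (ℂ → ℂ) → List (Literature.Probability.LatticeModels.Site 2) → ℝ := fun δ s xs => let l := xs.map (Literature.Probability.LatticeModels.meshPoint δ); κ₁ δ * (List.zipWith (fun p q : ℂ => (s ((p + q) / 2)).re * (((q - p).re) ^ 2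 - ((q - p).im) ^ 2) / δ ^ 2) l l.tail).sum + κ₂ δ * (List.zipWith3 (fun p q r : ℂ => (s q).im * ((r - p).re * (r - p).im) / δ ^ 2) l l.tail l.tail.tail).sum; let fbar : Literature.Probability.RandomPlanarGeometry.CurveClass ℂ → ℝ := fun c => ∫ t in (0 : ℝ)..1, f (Literature.Probability.RandomPlanarGeometry.CurveClass.map ⟨φ t, hφ t⟩ c); Filter.Tendsto (fun δ : ℝ => (∫ γ, f (Literature.Probability.RandomPlanarGeometry.CurveClass.map ⟨φ 1, hφ 1⟩ γ.curve) ∂(P D.carrier δ)) - (∫ γ, f γ.curve ∂(P D.carrier δ)) - ((∫ γ, fbar γ.curve * quad δ (strain v) γ.walk.support ∂(P D.carrier δ)) - (∫ γ, fbar γ.curve ∂(P D.carrier δ)) * (∫ γ, quad δ (strain v) γ.walk.support ∂(P D.carrier δ)))) (nhdsWithin 0 (Set.Ioi 0)) (nhds 0)) → ∀ (D : Literature.Probability.RandomPlanarGeometry.DobrushinDomain) (a b : ℝ → Literature.Probability.LatticeModels.Site 2), Literature.Probability.RandomPlanarGeometry.SAW.IsEndpointApprox D a b → let P := fun (Ω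 : Set ℂ) (δ : ℝ) => Literature.Probability.RandomPlanarGeometry.SAW.law Ω δ (a δ) (b δ); ∀ (u : ℂ → ℂ) (U : Set ℂ), IsOpen U → closure D.carrier ⊆ U → DifferentiableOn ℂ u U → ContDiff ℝ 2 u → u (D.pt 0) = 0 → u (D.pt 1) = 0 → ∀ (g : ℝ → ℂ → ℂ) (hg : ∀ t, Continuous (g t)) (t₀ : ℝ), 0 < t₀ → (∀ z, g 0 z = z) → (∀ t, ∃ K, LipschitzWith K (g t)) → (∀ t ∈ Set.Icc (0 : ℝ) t₀, ∀ z ∈ closure D.carrier, HasDerivAt (fun r => g r z) (u (g t z)) t) → (∀ t ∈ Set.Icc (0 : ℝ) t₀, g t '' D.carrier ⊆ D.carrier) → (∀ t ∈ Set.Icc (0 : ℝ) t₀, ∀ᶠ δ in nhdsWithin 0 (Set.Ioi 0), (Literature.Probability.LatticeModels.discreteDomainGraph (g t '' D.carrier) δ).Reachable (a δ) (b δ)) → ∀ (K : Set ℂ), IsCompact K → K ⊆ g t₀ '' D.carrier → ∀ (χ : ℂ → ℝ), ContDiff ℝ 2 χ → (∀ᶠ z in nhdsSet K, χ z = 1)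 → tsupport χ ⊆ g t₀ '' D.carrier → ∀ f : BoundedContinuousFunction (Literature.Probability.RandomPlanarGeometry.CurveClass ℂ) ℝ, (∀ ψ : ℂ ≃ₜ ℂ, (∀ z ∈ K, ψ z = z) → ∀ c, f (Literature.Probability.RandomPlanarGeometry.CurveClass.map (ψ : C(ℂ, ℂ)) c) = f c) → ∀ t ∈ Set.Ioc (0 : ℝ) t₀, let strain : (ℂ → ℂ) → ℂ → ℂ := fun w z => fderiv ℝ w z 1 + Complex.I * fderiv ℝ w z Complex.I; let quad : ℝ → (ℂ → ℂ) → List (Literature.Probability.LatticeModels.Site 2) → ℝ := fun δ s xs => let l := xs.map (Literature.Probability.LatticeModels.meshPoint δ); κ₁ δ * (List.zipWith (fun p q : ℂ => (s ((p + q) / 2)).re * (((q - p).re) ^ 2 - ((q - p).im) ^ 2) / δ ^ 2) l l.tail).sum + κ₂ δ * (List.zipWith3 (fun p q r : ℂ => (s q).im * ((r - p).re * (r - p).im) / δ ^ 2) l l.tail l.tail.tail).sum; let v : ℂ → ℂ := fun z => (χ z : ℂ) * u z; Filter.Tendsto (fun δ : ℝ => (∫ γ, f γ.curve ∂(P (g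 t '' D.carrier) δ)) - (∫ γ, f γ.curve ∂(P D.carrier δ)) - ∫ s in (0 : ℝ)..t, ((∫ γ, f γ.curve * quad δ (strain v) γ.walk.support ∂(P (g s '' D.carrier) δ)) - (∫ γ, f γ.curve ∂(P (g s '' D.carrier) δ)) * (∫ γ, quad δ (strain v) γ.walk.support ∂(P (g s '' D.carrier) δ)))) (nhdsWithin 0 (Set.Ioi 0)) (nhds 0) := by
  intro κ₁ κ₂ hIW D a b hab P u U hU hDU hud huc hua hub g hg t₀ ht₀ hg0 hgL hgd hgD hreach
    K hK hKD χ hχ hχ1 hχD f hf t ht strain quad v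
  -- names for the quantities along the orbit (all plain functions of real parameters)
  let F : ℝ → ℝ → ℝ := fun s δ => ∫ γ, f γ.curve ∂(P (g s '' D.carrier) δ)
  let Cv : ℝ → ℝ → ℝ := fun r δ =>
    (∫ γ, f γ.curve * quad δ (strain v) γ.walk.support ∂(P (g r '' D.carrier) δ)) -
      (∫ γ, f γ.curve ∂(P (g r '' D.carrier) δ)) *
        (∫ γ, quad δ (strain v) γ.walk.support ∂(P (g r '' D.carrier) δ))
  let J : ℝ → ℝ → ℝ := fun s δ => ∫ r in (0:ℝ)..s, Cv r δ
  let Conf : (s h δ : ℝ) → Set (DomainSAW (g s '' D.carrier) δ (a δ) (b δ)) := fun s h δ =>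
    {γ | ∃ γ' : DomainSAW (g (s + h) '' D.carrier) δ (a δ) (b δ), γ'.walk.support = γ.walk.support}
  let q : ℝ → ℝ → ℝ → ℝ := fun s h δ => ((P (g s '' D.carrier) δ) (Conf s h δ)ᶜ).toReal
  let A : ℝ → ℝ → ℝ → ℝ := fun s h δ => ∫ γ in (Conf s h δ)ᶜ, f γ.curve ∂(P (g s '' D.carrier) δ)
  -- Step 1: the uniform one-step estimate from the four pieces
  have hsteps : ∀ η : ℝ, 0 < η → ∃ h₀ : ℝ, 0 < h₀ ∧ ∀ s ∈ Set.Icc (0:ℝ) t₀,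
      ∀ h ∈ Set.Ioc (0:ℝ) h₀, s + h ≤ t₀ →
        ∀ᶠ δ in 𝓝[>] (0:ℝ), |F (s + h) δ - F s δ - (J (s + h) δ - J s δ)| ≤ η * h := by
    intro η hη
    obtain ⟨L, h₁, hh₁, HV⟩ :=
      hV D a b hab u U hU hDU hud huc hua hub g hg t₀ ht₀ hg0 hgL hgd hgD hreach
    obtain ⟨h₂, hh₂, HP⟩ := hP κ₁ κ₂ hIW D a b hab u U hU hDU hud huc hua hub g hg t₀ ht₀ hg0
      hgL hgd hgD hreach K hK hKD χ hχ hχ1 hχD f hf (η / 3) (by positivity)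
    obtain ⟨h₃, hh₃, HC⟩ := hC κ₁ κ₂ hIW D a b hab u U hU hDU hud huc hua hub g hg t₀ ht₀ hg0
      hgL hgd hgD hreach K hK hKD χ hχ hχ1 hχD f hf (η / 3) (by positivity)
    set L' : ℝ := max L 1 with hL'
    have hL'1 : 1 ≤ L' := le_max_right _ _
    have hL'pos : 0 < L' := by positivity
    set B : ℝ := ‖f‖ with hB
    have hB0 : 0 ≤ B := norm_nonneg f
    refine ⟨min (min h₁ (min h₂ h₃)) (min (1 / (2 * L')) ((η / 3) / (4 * B * L' ^ 2 + 1))),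
      by positivity, ?_⟩
    intro s hs h hh hsh
    have hh0 : 0 < h := hh.1
    have hhA : h ≤ min h₁ (min h₂ h₃) := hh.2.trans (min_le_left _ _)
    have hhB : h ≤ min (1 / (2 * L')) ((η / 3) / (4 * B * L' ^ 2 + 1)) :=
      hh.2.trans (min_le_right _ _)
    have hh1 : h ≤ h₁ := hhA.trans (min_le_left _ _)
    have hh2 : h ≤ h₂ := hhA.trans ((min_le_right _ _).trans (min_le_left _ _))
    have hh3 : h ≤ h₃ := hhA.trans ((min_le_right _ _).trans (min_le_right _ _))
    have hhL : h ≤ 1 / (2 * L') := hhB.trans (min_le_left _ _)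
    have hhη : h ≤ (η / 3) / (4 * B * L' ^ 2 + 1) := hhB.trans (min_le_right _ _)
    -- the four pieces at this step
    have eR : ∀ᶠ δ in 𝓝[>] (0:ℝ), IsProbabilityMeasure (P (g s '' D.carrier) δ) ∧
        F (s + h) δ * ((P (g s '' D.carrier) δ) (Conf s h δ)).toReal =
          ∫ γ in Conf s h δ, f γ.curve ∂(P (g s '' D.carrier) δ) :=
      hR D a b hab u U hU hDU hud huc hua hub g hg t₀ ht₀ hg0 hgL hgd hgD hreach f s hs h hh0 hsh
    have eV : ∀ᶠ δ in 𝓝[>] (0:ℝ), q s h δ ≤ L * h := HV s hs h ⟨hh0, hh1⟩ hsh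
    have eP : ∀ᶠ δ in 𝓝[>] (0:ℝ), |(A s h δ - F s δ * q s h δ) + h * Cv s δ| ≤ η / 3 * h :=
      HP s hs h ⟨hh0, hh2⟩ hsh
    have eC : ∀ᶠ δ in 𝓝[>] (0:ℝ), |h * Cv s δ - (J (s + h) δ - J s δ)| ≤ η / 3 * h :=
      HC s hs h ⟨hh0, hh3⟩ hsh
    filter_upwards [eR, eV, eP, eC] with δ hRδ hVδ hPδ hCδ
    obtain ⟨hprob, hid⟩ := hRδ
    -- measure theory at this mesh
    have hq1 : ((P (g s '' D.carrier) δ) (Conf s h δ)).toReal = 1 - q s h δ :=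
      toReal_eq_one_sub_toReal_compl _ _
    have hAF : ∫ γ in Conf s h δ, f γ.curve ∂(P (g s '' D.carrier) δ) = F s δ - A s h δ :=
      setIntegral_eq_integral_sub_compl f _ _
    have hΘ : |A s h δ - F s δ * q s h δ| ≤ 2 * B * q s h δ :=
      abs_setIntegral_sub_mul_le f _ _
    rw [hq1, hAF] at hid
    -- the abstract one-step estimate
    have hqL : q s h δ ≤ L' * h :=
      hVδ.trans (mul_le_mul_of_nonneg_right (le_max_left _ _) hh0.le)
    have hLh : L' * h ≤ 1 / 2 := by
      calc L' * h ≤ L' * (1 / (2 * L')) := by gcongr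
        _ = 1 / 2 := by field_simp
    have hsmall : 4 * B * L' ^ 2 * h ≤ η / 3 := by
      have h1 : 4 * B * L' ^ 2 * h ≤ (4 * B * L' ^ 2 + 1) * h := by nlinarith
      have h2 : (4 * B * L' ^ 2 + 1) * h ≤ η / 3 := by
        rwa [← le_div_iff₀' (by positivity)] 
      exact h1.trans h2
    have key := abs_step_le (B := B) (L := L') (η := η / 3) hB0 hh0.le ENNReal.toReal_nonneg hqL
      hLh hid hΘ hPδ hCδ hsmall
    calc |F (s + h) δ - F s δ - (J (s + h) δ - J s δ)| ≤ 3 * (η / 3) * h := key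
      _ = η * h := by ring
  -- Step 2: telescoping, and identification with the crux's conclusion
  have key := tendsto_of_uniform_steps hsteps ht
  have h0 : g 0 '' D.carrier = D.carrier := by
    have : g 0 = id := funext hg0
    rw [this, Set.image_id]
  have hF0 : ∀ δ', F 0 δ' = ∫ γ, f γ.curve ∂(P D.carrier δ') := by
    intro δ'
    show (fun Ω => ∫ γ, f γ.curve ∂(P Ω δ')) (g 0 '' D.carrier) =
      (fun Ω => ∫ γ, f γ.curve ∂(P Ω δ')) D.carrier
    rw [h0]
  have hJ0 : ∀ δ', J 0 δ' = 0 := fun δ' => intervalIntegral.integral_same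
  refine key.congr fun δ' => ?_
  rw [hF0 δ', hJ0 δ', sub_zero]

/-- **Composition (kernel-checked): `ExactRestriction` (PROVED, §1b) and the three registered stubs
imply the crux BY NAME.** [folklore] -/
theorem BoundaryWard_of (h2 : Registered.stub_stripAvoidance)
    (h3 : Registered.stub_collarTouching) (h4 : Registered.stub_responseContinuity) :
    Summit.CriticalPhenomena.SAWScalingLimit.Theses.SAWQuadrupoleWard.BoundaryWard :=
  boundaryWard_of_subs ExactRestrictionProof.exactRestriction h2 h3 h4

/-- Hypothesis-free form: the crux modulo the three sorried stubs. -/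
example : Summit.CriticalPhenomena.SAWScalingLimit.Theses.SAWQuadrupoleWard.BoundaryWard :=
  BoundaryWard_of stub_stripAvoidance stub_collarTouching stub_responseContinuity

end Summit.CriticalPhenomena.SAWScalingLimit.Cruxes.BoundaryWard.CollarStepTelescoping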